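import Mathlib
import Literature.MathematicalPhysics.QuantumFieldTheory.Balaban1983to89.B4

/-!
# `Balaban1983to89.B2` — T. Bałaban, *(Higgs)₂,₃ quantum fields in a finite volume. II. An upper bound*,
Commun. Math. Phys. **86**, 555–594 (1982).  (INDEX: B2 — a CONTEXT paper of the cell's series B1–B16; its
companion papers are [1] = (Higgs)₂,₃ I, CMP 85:603 (B1) and III, CMP 88:411 (B3).)
PDF held: `paper:balaban1982-cmp86-higgs23-ii` (doi 10.1007/bf01214890; journal page = PDF page + 554; 40 pp.).

CITATION HEADER (lean-in-tree rule 2026-08-18).  This module is a TYPED SKELETON (statement level) of ONE located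
passage of the published paper [Balaban1982Higgs2]: the inequality **(3.42)** p. 592 [PDF 38] together with the text
that fixes its meaning — the functions `p(ε) = b₀(1 + log ε⁻¹)^p, p > 2` (p. 557) and `r(ε) = R(1 + log ε⁻¹)^r,
r > 1, R > R₀` ((2.7) p. 558), the stopping rule "K is such that L^K ε ≤ ε₀, L^{K+1} ε > ε₀" and the uniformity
clause "with the constant O(1) independent of ε" ((2.116)–(2.117) p. 582), the small factors ζ″ of (3.41) p. 592, and
the concluding proviso of Sect. 3.C p. 594 [PDF 40]: *"if 2p ≥ (d+1)r and ε₀ is sufficiently small. Thus from (3.47)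
inequality (3.42) follows"*.  WHY THIS PASSAGE: it is the by-reference proof of Corollary 3 (ultraviolet stability,
(2.50)) of B14 = [Balaban1988Convergent] p. 264: *"Thus we estimate the integral ∫dV_k ρ_k by a sum of terms similar
to the one considered in Sect. 3 [6], e.g., see (3.42). The procedure is constructed in such a way, that the
combinatorics now is the same, relative to the η-scale of the lattice T_η, as in [6], hence we have the same result
for this scale."* ([6] of B14 = this paper; typed consumer: the remark before the surge-node section of
`…Balaban1983to89.B14`, the leaf `…Balaban1983to89.B16.Cor3Leaf`, cell GAPS.md G-adv3-1 / G-adv3-2 / G-r2.5).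
WHAT IS REPRODUCED: the displayed inequality (3.42) as a `Prop` over an abstract carrier (`Run`) whose fields NAME the
printed combinatorial quantities (the finite set of admissible sequences (Λ₀⁽⁰⁾, …, Λ₀⁽ᴷ⁻¹⁾) of p. 566, the factors
ζ″_{Λ₀⁽ᵏ⁾} of (3.41), the volumes |Λ₇⁽ᵏ⁻¹⁾′ ∩ Λ₇⁽ᵏ⁾ᶜ|, |Λ₅⁽ᵏ⁻¹⁾′ ∩ Λ₅⁽ᵏ⁾ᶜ|, |T_ε|, and the two O(1) constants
GIVEN on the left side), with every printed quantifier made explicit (`Claim342Printed`: the exponent condition, then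
the ε₀-threshold, then the constant O(1), then the run).  (Higgs)₂,₃ objects are not the Yang–Mills objects of the
cell's `Setup` vocabulary, so — like the sibling context-free modules `.B10`, `.B11`, `.B15` — this file restates
nothing of `Setup` (it imports Mathlib and, since the addendum at the end of the file, the equally `Setup`-free
`…Balaban1983to89.B4`, for the one comparison theorem `ineq329_of_prop31Printed`).
NOTHING of the paper is asserted: `Claim342Printed` is consumed downstream only as a hypothesis; the series'
end-statement is a CLAIM UNDER ADJUDICATION by the audit cell `pub-balaban`, and this context paper is not part of that
claim except through the B14 p. 264 reference above.  KERNEL-CHECKED here (the audit's "second engine", elementary real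
arithmetic only, zero `sorry`): the model-independent arithmetic of Sect. 3.C pp. 593–594 — (3.45) ⇒ the exponent
comparison behind the first inequality of (3.46) with the printed `c₀ = min{⅛a3⁻ᵈ, ¼γ₀3⁻ᵈ, 3⁻ᵈ}` (`step346_exponent`);
the exchange of summations and the inner bound of (3.53) *"because K ≤ (log L)⁻¹ log ε⁻¹, K − k ≤ (log L)⁻¹
log(Lᵏε)⁻¹ and r ≥ 2"* (`sum353_exchange`, `inner353_bound` — the kernel check uses exactly `2 ≤ r`; (2.7) p. 558
prints `r > 1`: cell GAPS.md G-pv04-2); and the per-scale sign condition of (3.54) (`coeff354_nonneg`: under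
2p ≥ (d+1)r it is the constant condition `O(1)R^{d+1} ≤ c₀b₀²(1 + log(Lᵏε)⁻¹)^{2p−(d+1)r}`, which the ε₀-smallness
discharges when the exponent inequality is STRICT, `coeff354_threshold`, every scale k ≤ K − 1 having
1 + log(Lᵏε)⁻¹ ≥ 1 + log ε₀⁻¹ by the stopping rule, `logScale_ge`; `sum354_nonpos`).  NOT reproduced: Sects. 1–3.B
(the renormalization procedure, the positivity bounds, (2.43), (3.22)–(3.41)), the geometric covering statements
(3.43)–(3.45), (3.48)–(3.52) (cubes of side between r(ε) and 2r(ε), corridors of thickness between 9r(ε) and 10r(ε)) and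
the counting step (3.46) ⇒ (3.47) ("After easy transformations we get") — quoted below, not typed; their reading is the
cell's GAPS.md row G-pv04-2 and DIVERGENCE.md row D-pv04.2.
Staged byte-identically in the cell package
`run/shared/lean/pub/pub-balaban/lean/BalabanYm4/Literature/MathematicalPhysics/QuantumFieldTheory/Balaban1983to89/B2.lean`.

Unit `b2b-balaban-pv04` (surge node prover #04; cell LEMMAS.md PHASE-2 row P00, part "(3.42) + its hypothesis").
Source of every quotation: the page renders `HOME/b2b-balaban-ref1/pages/1982-cmp86-higgs23-II/…-p003, p004, p012,
p028, p038, p039, p040-x2.png` (journal pp. 557, 558, 566, 582, 592, 593, 594).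

ADDENDUM (unit `b2b-balaban-pv07`, surge node prover #07; PHASE-2 row P00, remainder "the items of II cited by B4–B16"):
the last section of this file types the OTHER two located passages of this paper that the series cites — Proposition
3.1 (3.26) p. 589 with its reduction (3.27)–(3.29) p. 589–590 (the passage B4 = [Balaban1983RegularityDecay] p. 574
calls "Proposition 3.1′ of [2]" / "This theorem implies (3.29) of [2]"), and the conditional-integration formula (2.28)
p. 563 (cited by B13 p. 12 "(2.28) [6]") — verbatim over abstract carriers, with the printed implications kernel-checked
as arithmetic; the declarations of unit pv04 above are untouched.  Renders used: `…-p005, p009, p034, p035, p036-x2.png`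
(journal pp. 559, 563, 588, 589, 590).
ADDENDUM 2 (unit `b2b-balaban-pv07`, gen 2, 2026-08-18; census G-B4-06 (c); everything above this paragraph is unchanged):
the new last section types **Lemma 2.4** (2.65)–(2.66) p. 572 with its hypothesis, the restrictions (2.55) p. 570, as
a quoted leaf (`Lemma24Printed`), and kernel-checks the algebra of its PROOF pp. 572–573 — which is what B4 =
[Balaban1983RegularityDecay] p. 591 actually imports (*"inspect closely the proof of the Lemma II.2.4 … 'gauge away'
the configuration A₀ … Then using II.2.75 we have (4.9)"*): the expansion step (2.68) given (I.3.44), the group-law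
step (2.69), Stokes for a constant field (the sentence after (2.69)), (2.70), the conjugation (2.73), and (2.75) with
its solved form (2.62)–(2.63) p. 571.  Renders used: `…-p016, p017, p018, p019, p020-x2.png` (pp. 570–574).  FINDING
(cell DIVERGENCE.md D-pv07.7, immaterial): (2.75) solved gives a_kG_k(□,0)Q_k^*1 = (a_k/(a_k + m²(L^kε)²))·1
(`display263`, = (2.63)), where B4 (4.9)–(4.10) p. 590–591 print the coefficient 1/(1 + m²); B4's own next line
notes that the terms carrying it vanish (*"(φ(x)·qφ(x) = 0 because q is an antisymmetric matrix)"*).  Journal claim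
`P00-G-B4-06`.
-/

namespace Literature.MathematicalPhysics.QuantumFieldTheory.Balaban1983to89.B2

open Finset

/-! ## The scale functions `p(ε)`, `r(ε)` and the printed parameter constraints -/

/-- *"It follows from the definition of p(ε) = b₀(1 + log ε⁻¹)ᵖ, p > 2, that exp(−c₀p(ε)²) is smaller than the
arbitrary power εᴷ"* (real exponent `p`; `Real.rpow`). [cite: Balaban1982Higgs2, p.557] -/
noncomputable def pFn (b₀ p ε : ℝ) : ℝ := b₀ * (1 + Real.log ε⁻¹) ^ p

/-- (2.7): *"… distant from one of the sets B(P_v), Q_v, R_v, B(P_s), Q_s, R_s less than r(ε) = R(1 + log ε⁻¹)ʳ. The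
numbers r, R satisfy r > 1, R > R₀ (R₀ occurs in the formulation of Proposition I.2.1)."* [cite: Balaban1982Higgs2, (2.7) p.558] -/
noncomputable def rFn (R r ε : ℝ) : ℝ := R * (1 + Real.log ε⁻¹) ^ r

/-- The fixed parameters of the construction that (3.42) and Sect. 3.C refer to: the dimension `d` (= 2, 3), the
scaling factor `L` (an integer > 1), `b₀, p` of p(ε) (p. 557), `R, r` of r(ε) ((2.7) p. 558), the positivity constants
`a` (the positive constant of the action (2.1), p. 557: (2.3) holds *"with some positive constant c₀, e.g.
c₀ = ½ min{a, 1}"* — a c₀ distinct from the one of (3.46)) and `γ₀` entering ζ″ (3.41), and the exponent `κ₀` (*"κ₀ = 1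
for d = 3 and κ₀ = 2 − α with arbitary [sic] α > 0 for d = 2"*, p. 559).  The stopping scale ε₀ (p. 582) is quantified in
`Claim342Printed`. [cite: Balaban1982Higgs2, pp.557–559, 582] -/
structure Params where
  d : ℕ
  L : ℕ
  b₀ : ℝ
  p : ℝ
  R : ℝ
  r : ℝ
  a : ℝ
  γ₀ : ℝ
  κ₀ : ℝ

/-- The printed constraints on the parameters: `p > 2` (p. 557), `r > 1` ((2.7) p. 558; Sect. 3.C p. 594 uses
"r ≥ 2" — see `inner353_bound` and cell GAPS.md G-pv04-2), `L > 1`, `d = 2 ∨ d = 3` (Theorem p. 556 "For the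
dimensions d = 2, 3"), `a > 0`, `γ₀ > 0`, `b₀ > 0`, `R > 0` (R > R₀). [cite: Balaban1982Higgs2, pp.556–558] -/
def Params.Printed (P : Params) : Prop :=
  2 < P.p ∧ 1 < P.r ∧ 1 < P.L ∧ (P.d = 2 ∨ P.d = 3) ∧ 0 < P.a ∧ 0 < P.γ₀ ∧ 0 < P.b₀ ∧ 0 < P.R

/-! ## (3.41)–(3.42) p. 592 and the claim of Sect. 3.C

(3.41) [PDF 38], verbatim: `ζ″_{Λ₀⁽ᵏ⁾} = Σ_{{P_v⁽ᵏ⁾,…,R_s⁽ᵏ⁾} admissible, minimal} exp(−⅛ap(Lᵏε)²|P_v⁽ᵏ⁾|)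
exp(−¼γ₀p(Lᵏε)²|Q_v⁽ᵏ⁾|) exp(−¼γ₀p(Lᵏε)²|R_v⁽ᵏ⁾|) exp(−⅛ap(Lᵏε)²|P_s⁽ᵏ⁾|) exp(−¼γ₀p(Lᵏε)²|Q_s⁽ᵏ⁾|)
exp(−p(Lᵏε)²|R_s⁽ᵏ⁾|)` ("admissible, minimal": (2.9) p. 558 — the minimal elements of the resummation, each pair of
elements of P_v ∪ … ∪ R_s at distance > r(ε)); p. 592: *"To prove the inequality (2.117), which is the fundamental
inequality necessary to complete the proof of the upper bound, it is sufficient to show that*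
`Σ_{Λ₀⁽⁰⁾,…,Λ₀⁽ᴷ⁻¹⁾} Π_{k=0}^{K−1} ζ″_{Λ₀⁽ᵏ⁾} · exp(Σ_{k=0}^{K} O(1)(Lᵏε)^{κ₀}|Λ₇⁽ᵏ⁻¹⁾′ ∩ Λ₇⁽ᵏ⁾ᶜ|) ·
exp(Σ_{k=0}^{K} O(1)|Λ₅⁽ᵏ⁻¹⁾′ ∩ Λ₅⁽ᵏ⁾ᶜ|) ≤ exp(O(1)|T_ε|).   (3.42)`
*C. The Combinatorial Estimate.  In this section we will prove the inequality (3.42). The proof is purely combinatoric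
and model-independent."*  The word "admissible" for the sequence Λ₀⁽ʲ⁾ is fixed on p. 566 [PDF 12]: *"the sets Λ₀⁽ʲ⁾
have to satisfy all the conditions resulting from the construction. The sets are unions of big blocks, the set Λ₀⁽⁰⁾ᶜ is
either empty or has at least one point whose distance from Λ₀⁽⁰⁾ is bigger than r(ε). In general Λ₀⁽ʲ⁺¹⁾ ⊂ Λ₇⁽ʲ⁾′, and
either Λ₀⁽ʲ⁺¹⁾ is a maximal set composed of big blocks and satisfying this inclusion, or the set Λ₀⁽ʲ⁺¹⁾ᶜ ∩ Λ₇⁽ʲ⁾′ has at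
least one point whose distance from Λ₀⁽ʲ⁺¹⁾ is bigger than r(Lʲ⁺¹ε), and so on."*; p. 592: *"Here and in the sequel the
symbol |·| means the number of elements in a given set."* -/

/-- Abstract carrier for ONE instance of (3.42): one lattice spacing `ε` (with its torus T_ε, `volT` = |T_ε|), the
number of steps `K` (p. 582: L^K ε ≤ ε₀ < L^{K+1} ε), the FINITE type `Seq` of admissible sequences
(Λ₀⁽⁰⁾, …, Λ₀⁽ᴷ⁻¹⁾) (p. 566), and, as functions of (k, sequence): `zeta k s` = ζ″_{Λ₀⁽ᵏ⁾} of (3.41) (k = 0 … K−1),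
`vol7 k s` = |Λ₇⁽ᵏ⁻¹⁾′ ∩ Λ₇⁽ᵏ⁾ᶜ| and `vol5 k s` = |Λ₅⁽ᵏ⁻¹⁾′ ∩ Λ₅⁽ᵏ⁾ᶜ| (k = 0 … K); `C₇`, `C₅` = the two O(1)
constants GIVEN on the left side of (3.42) (they come from (2.43), (2.13)–(2.14)).  Nothing about how these were built
is recorded — (3.42) is "purely combinatoric and model-independent" (p. 592); cell DIVERGENCE.md D-pv04.2. [cite: Balaban1982Higgs2, (3.41)–(3.42) p.592; p.566; p.582] -/
structure Run where
  ε : ℝ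
  K : ℕ
  volT : ℕ
  Seq : Type
  [fin : Fintype Seq]
  zeta : ℕ → Seq → ℝ
  vol7 : ℕ → Seq → ℕ
  vol5 : ℕ → Seq → ℕ
  C₇ : ℝ
  C₅ : ℝ

/-- The left side of (3.42), verbatim: `Σ_{sequences} Π_{k=0}^{K−1} ζ″_{Λ₀⁽ᵏ⁾} · exp(Σ_{k=0}^{K} C₇ (Lᵏε)^{κ₀}
|Λ₇⁽ᵏ⁻¹⁾′ ∩ Λ₇⁽ᵏ⁾ᶜ|) · exp(Σ_{k=0}^{K} C₅ |Λ₅⁽ᵏ⁻¹⁾′ ∩ Λ₅⁽ᵏ⁾ᶜ|)`. [cite: Balaban1982Higgs2, (3.42) p.592] -/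
noncomputable def lhs342 (P : Params) (ρ : Run) : ℝ :=
  letI := ρ.fin
  ∑ s : ρ.Seq, (∏ k ∈ range ρ.K, ρ.zeta k s)
    * Real.exp (∑ k ∈ range (ρ.K + 1), ρ.C₇ * ((P.L : ℝ) ^ k * ρ.ε) ^ P.κ₀ * (ρ.vol7 k s : ℝ))
    * Real.exp (∑ k ∈ range (ρ.K + 1), ρ.C₅ * (ρ.vol5 k s : ℝ))

/-- (3.42) with the right-side constant O(1) =: `C` as an explicit binder: `lhs342 ≤ exp(C |T_ε|)`. [cite: Balaban1982Higgs2, (3.42) p.592] -/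
def Ineq342With (P : Params) (ρ : Run) (C : ℝ) : Prop :=
  lhs342 P ρ ≤ Real.exp (C * (ρ.volT : ℝ))

/-- The stopping rule of p. 582 for a run built with stopping scale ε₀: *"The procedure is continued until k = K, where
K is such that Lᴷε ≤ ε₀, Lᴷ⁺¹ε > ε₀."* [cite: Balaban1982Higgs2, p.582] -/
def Run.StopsAt (P : Params) (ε₀ : ℝ) (ρ : Run) : Prop :=
  (P.L : ℝ) ^ ρ.K * ρ.ε ≤ ε₀ ∧ ε₀ < (P.L : ℝ) ^ (ρ.K + 1) * ρ.ε

/-- **The claim of Sect. 3.C** (pp. 592–594) with its printed proviso and the uniformity clause of (2.117) p. 582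
(*"with the constant O(1) independent of ε"*), quantifiers explicit.  `fam ε₀ i` = the run produced by the construction
with stopping scale ε₀ in the instance `i` (lattice spacing, torus, field data integrated out — the index type `I` is
abstract).  Reading: IF `2p ≥ (d+1)r` THEN there is a threshold ε₁ > 0 such that for every stopping scale
0 < ε₀ ≤ ε₁ ("ε₀ is sufficiently small", p. 594) there is a constant C (independent of the instance, in particular
of ε and T_ε) with (3.42) for every run of the family with 0 < ε ≤ ε₀ obeying the stopping rule.  A quoted leaf:
NOT proved here, NOT asserted; the threshold-and-index reading is cell DIVERGENCE.md D-pv04.2. [cite: Balaban1982Higgs2, (3.42) p.592 + proviso p.594 + (2.117) p.582] -/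
def Claim342Printed {I : Type} (P : Params) (fam : ℝ → I → Run) : Prop :=
  ((P.d : ℝ) + 1) * P.r ≤ 2 * P.p →
    ∃ ε₁ : ℝ, 0 < ε₁ ∧ ∀ ε₀ : ℝ, 0 < ε₀ → ε₀ ≤ ε₁ →
      ∃ C : ℝ, ∀ i : I, 0 < (fam ε₀ i).ε → (fam ε₀ i).ε ≤ ε₀ → (fam ε₀ i).StopsAt P ε₀ →
        Ineq342With P (fam ε₀ i) C

/-! ## Sect. 3.C pp. 592–594 — the printed proof, quoted, and its model-independent arithmetic kernel-checked

The whole of Sect. 3.C, keyed word for word from the page renders `HOME/b2b-balaban-ref1/pages/1982-cmp86-higgs23-II/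
…-p038, p039, p040-x2.png` (journal pp. 592–594; the print's ≦ / ≧ rendered ≤ / ≥, displays linearised; DOCFIX of the
v1/v2 paraphrases, cell GAPS.md G-pv18-3).  p. 592: *"C. The Combinatorial Estimate.  In this section we will prove the
inequality (3.42). The proof is purely combinatoric and model-independent. At first we introduce the quantities which
we will use later to express all the other quantities.  Let us consider a regular partition of T₁ into a lattice of
cubes, each cube is a sum of large blocks and a length of its side is bigger r(ε), and less 2r(ε). Let us define 𝒞₀ as
the set of the cubes having common points with Λ₀⁽⁰⁾ᶜ. Thus  Λ₀⁽⁰⁾ᶜ ⊂ ⋃_{□∈𝒞₀} □ = ∪𝒞₀.  (3.43)  Now if to every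
element of the set P_v⁽⁰⁾ ∪ … ∪ R_s⁽⁰⁾ we assign a cube □ having a common point with this element and 3ᵈ − 1 cubes
neighbouring with □, then the sum of all these cubes contains the set ∪𝒞₀. It is so because a distance of each large
block contained in Λ₀⁽⁰⁾ᶜ from the set P_v⁽⁰⁾ ∪ … ∪ R_s⁽⁰⁾ is ≤ r(ε). Thus we have  |𝒞₀| ≤ 3ᵈ(|P_v⁽⁰⁾| + … + |R_s⁽⁰⁾|).
(3.44)  Here and in the sequel the symbol |·| means the number of elements in a given set.  In a similar way we divide
T₁⁽ᵏ⁾ into a regular lattice of cubes consisting of large blocks and having sides of length bigger than r(Lᵏε) and less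
than 2r(Lᵏε). We define 𝒞_k as the set of these cubes, which have the common points with Λ₇⁽ᵏ⁻¹⁾′ ∩ Λ₀⁽ᵏ⁾ᶜ. Because
each large block of the lattice T₁⁽ᵏ⁾ contained in Λ₀⁽ᵏ⁾ᶜ and having common points with Λ₇⁽ᵏ⁻¹⁾′ has the distance from
the set P_v⁽ᵏ⁾ ∪ … ∪ R_s⁽ᵏ⁾ less than or equal to r(Lᵏε), so  |𝒞_k| ≤ 3ᵈ(|P_v⁽ᵏ⁾| + … + |R_s⁽ᵏ⁾|).  (3.45)"*
p. 593: *"The sets 𝒞_k, more exactly their numbers of elements |𝒞_k|, will be just these basic quantities and we will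
express the other quantities with their help. Let us define c₀ = min{⅛a3⁻ᵈ, ¼γ₀3⁻ᵈ, 3⁻ᵈ}. From (3.41) we have
ζ″_{Λ₀⁽ᵏ⁾} ≤ Σ_{{P_v⁽ᵏ⁾,…,R_s⁽ᵏ⁾} admissible, minimal} exp(−c₀p(Lᵏε)²|𝒞_k|) ≤ Σ_{all the subsets of Λ₀⁽ᵏ⁾ᶜ}
exp(−c₀p(Lᵏε)²|𝒞_k|) = 2^{6|Λ₀⁽ᵏ⁾ᶜ|} exp(−c₀p(Lᵏε)²|𝒞_k|),  k = 0, 1, …, K − 1.  (3.46)  After easy transformations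
we get  (the left side of (3.42)) ≤ sup_{{Λ₀⁽⁰⁾,…,Λ⁽ᴷ⁻¹⁾} admissible} · exp(−Σ_{k=0}^{K−1} c₀p(Lᵏε)²|𝒞_k|)
· exp(Σ_{k=0}^{K−1} O(1)(1 + log(Lᵏε)⁻¹)|Λ₀⁽ᵏ⁾ᶜ|) · exp(O(1)|T₁⁽ᴷ⁾|).  (3.47)  In the second exponent we have gathered
all the expressions dependent on Λ₀⁽ᵏ⁾ᶜ. The third exponent has the required form and can be omitted in further
considerations. Now we will express |Λ₀⁽ᵏ⁾ᶜ| by the help of |𝒞_k|. We will construct a sequence 𝒟₀, 𝒟₁, …, 𝒟_{K−1}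
of families of cubes with the properties that Λ₀⁽ᵏ⁾ᶜ is contained in the sum of cubes of the family 𝒟_k. We take
𝒟₀ = 𝒞₀. Of course  Λ₀⁽⁰⁾ᶜ ⊂ ⋃_{□∈𝒟₀} □  and  |Λ₀⁽⁰⁾ᶜ| ≤ (2r(ε))ᵈ|𝒞₀|.  (3.48)  To each cube from 𝒟₀ we add a
"corridor" consisting of large blocks and of thickness >9r(ε), but <10r(ε). We get a cube with a side of length
<22r(ε) and we apply the operation ′ to it, i.e. we take the set of small blocks. After rescaling we get a cube of the
lattice T₁⁽¹⁾ with a side of length <L⁻¹22r(ε). We add 𝒞₁ to the obtained set of cubes and we denote the sum by 𝒟₁.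
From the definition of Λ₀⁽¹⁾ we have  Λ₀⁽¹⁾ᶜ ⊂ ⋃_{□∈𝒟₁} □  and  |Λ₀⁽¹⁾ᶜ| ≤ (L⁻¹22r(ε))ᵈ|𝒞₀| + (2r(Lε))ᵈ|𝒞₁|.  (3.49)
We continue this procedure and we get a sequence of families of cubes 𝒟₀, 𝒟₁, 𝒟₂, …, 𝒟_{K−1} with the following
properties  Λ₀⁽ᵏ⁾ᶜ ⊂ ⋃_{□∈𝒟_k} □  and  |Λ₀⁽ᵏ⁾ᶜ| ≤ (L⁻ᵏ22r(ε) + L^{−(k−1)}20r(Lε) + … + L⁻¹20r(Lᵏ⁻¹ε))ᵈ|𝒞₀|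
+ (L^{−(k−1)}22r(Lε) + … + L⁻¹20r(Lᵏ⁻¹ε))ᵈ|𝒞₁| + … + (L⁻¹22r(Lᵏ⁻¹ε))ᵈ|𝒞_{k−1}| + (2r(Lᵏε))ᵈ|𝒞_k|.  (3.50)"*
p. 594: *"The expression on the right sides of the above inequalities can be simplified. Thus
r(Lᵏ⁻ʲε) ≤ (1 + j log L)ʳ r(Lᵏε) and the factor standing at |𝒞_l| can be estimated by
(22r(Lᵏε))ᵈ(L^{−(k−1)}(1 + (k−1) log L)ʳ + … + L⁻¹(1 + log L)ʳ + 1) ≤ 22ᵈ Σ_{j=0}^∞ L⁻ʲ(1 + j log L)ʳ (r(Lᵏε))ᵈ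
= O(1)(r(Lᵏε))ᵈ,  (3.51)  hence  |Λ₀⁽ᵏ⁾ᶜ| ≤ O(1) r(Lᵏε)ᵈ(|𝒞₀| + … + |𝒞_k|).  (3.52)  We can estimate the sum in the
second exponent on the right side of (3.47) using the above inequality:  Σ_{k=0}^{K−1} O(1)(1 + log(Lᵏε)⁻¹)|Λ₀⁽ᵏ⁾ᶜ|
≤ Σ_{k=0}^{K−1} O(1) r(Lᵏε)ᵈ(1 + log(Lᵏε)⁻¹) Σ_{j=0}^{k} |𝒞_j| ≤ Σ_{k=0}^{K−1} O(1) r(Lᵏε)^{d+1}|𝒞_k|,  (3.53)  because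
K ≤ (log L)⁻¹ log ε⁻¹, K − k ≤ (log L)⁻¹ log(Lᵏε)⁻¹ and r ≥ 2. Now the sum on the right side of (3.43) together with
the sum in the first exponent on the right side of (3.47) give  −Σ_{k=0}^{K−1}(c₀p(Lᵏε)² − O(1) r(Lᵏε)^{d+1})|𝒞_k| ≤ 0
(3.54)  if 2p ≥ (d+1)r and ε₀ is sufficiently small. Thus from (3.47) inequality (3.42) follows and this ends the proof
of inequality (2.117)."*  READING NOTES (not print): "(3.43)" in the sentence before (3.54) is a misprint for (3.53);
the middle expression of (3.51) lacks the d-th power on its bracket (cell DIVERGENCE.md D-pv04.3 (b), (c)); the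
geometric statements (3.43)–(3.45), (3.48)–(3.52) and the step (3.46) ⇒ (3.47) are typed / kernel-checked where the
print states an implication in the sibling module `…Balaban1983to89.B2Sect3C` (unit pv04 gen 2), not here. -/

/-- The printed constant of (3.46): `c₀ = min{⅛a3⁻ᵈ, ¼γ₀3⁻ᵈ, 3⁻ᵈ}`. [cite: Balaban1982Higgs2, p.593] -/
noncomputable def c0 (a γ₀ : ℝ) (d : ℕ) : ℝ :=
  min (min (a / 8 / (3 : ℝ) ^ d) (γ₀ / 4 / (3 : ℝ) ^ d)) (1 / (3 : ℝ) ^ d)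

/-- `c₀ ≥ 0` for a, γ₀ ≥ 0. [folklore: arithmetic of the printed c₀, cite: Balaban1982Higgs2, p.593] -/
theorem c0_nonneg {a γ₀ : ℝ} (ha : 0 ≤ a) (hγ : 0 ≤ γ₀) (d : ℕ) : 0 ≤ c0 a γ₀ d := by
  unfold c0
  refine le_min (le_min ?_ ?_) ?_ <;> positivity

/-- (3.45) ⇒ the exponent comparison behind the first inequality of (3.46): if `|𝒞_k| ≤ 3ᵈ(|P_v| + |Q_v| + |R_v| +
|P_s| + |Q_s| + |R_s|)` then `c₀ p² |𝒞_k| ≤ ⅛a p²|P_v| + ¼γ₀ p²|Q_v| + ¼γ₀ p²|R_v| + ⅛a p²|P_s| + ¼γ₀ p²|Q_s| + p²|R_s|`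
(stated with the common factor p(Lᵏε)² divided out), so that each term of (3.41) is `≤ exp(−c₀p(Lᵏε)²|𝒞_k|)`.
[folklore: arithmetic of the printed c₀, cite: Balaban1982Higgs2, (3.45)–(3.46) pp.592–593] -/
theorem step346_exponent {a γ₀ : ℝ} {d : ℕ} (ha : 0 ≤ a) (hγ : 0 ≤ γ₀)
    {Pv Qv Rv Ps Qs Rs C : ℝ} (hPv : 0 ≤ Pv) (hQv : 0 ≤ Qv) (hRv : 0 ≤ Rv) (hPs : 0 ≤ Ps) (hQs : 0 ≤ Qs)
    (hRs : 0 ≤ Rs) (h345 : C ≤ (3 : ℝ) ^ d * (Pv + Qv + Rv + Ps + Qs + Rs)) :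
    c0 a γ₀ d * C ≤ a / 8 * Pv + γ₀ / 4 * Qv + γ₀ / 4 * Rv + a / 8 * Ps + γ₀ / 4 * Qs + Rs := by
  have h3 : 0 < (3 : ℝ) ^ d := by positivity
  have hc : 0 ≤ c0 a γ₀ d := c0_nonneg ha hγ d
  have h1 : c0 a γ₀ d * (3 : ℝ) ^ d ≤ a / 8 := by
    have : c0 a γ₀ d ≤ a / 8 / (3 : ℝ) ^ d := le_trans (min_le_left _ _) (min_le_left _ _)
    calc c0 a γ₀ d * (3 : ℝ) ^ d ≤ a / 8 / (3 : ℝ) ^ d * (3 : ℝ) ^ d :=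
          mul_le_mul_of_nonneg_right this h3.le
      _ = a / 8 := by field_simp
  have h2 : c0 a γ₀ d * (3 : ℝ) ^ d ≤ γ₀ / 4 := by
    have : c0 a γ₀ d ≤ γ₀ / 4 / (3 : ℝ) ^ d := le_trans (min_le_left _ _) (min_le_right _ _)
    calc c0 a γ₀ d * (3 : ℝ) ^ d ≤ γ₀ / 4 / (3 : ℝ) ^ d * (3 : ℝ) ^ d :=
          mul_le_mul_of_nonneg_right this h3.le
      _ = γ₀ / 4 := by field_simp
  have h4 : c0 a γ₀ d * (3 : ℝ) ^ d ≤ 1 := by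
    have : c0 a γ₀ d ≤ 1 / (3 : ℝ) ^ d := min_le_right _ _
    calc c0 a γ₀ d * (3 : ℝ) ^ d ≤ 1 / (3 : ℝ) ^ d * (3 : ℝ) ^ d :=
          mul_le_mul_of_nonneg_right this h3.le
      _ = 1 := by field_simp
  calc c0 a γ₀ d * C ≤ c0 a γ₀ d * ((3 : ℝ) ^ d * (Pv + Qv + Rv + Ps + Qs + Rs)) :=
        mul_le_mul_of_nonneg_left h345 hc
    _ = (c0 a γ₀ d * (3 : ℝ) ^ d) * Pv + (c0 a γ₀ d * (3 : ℝ) ^ d) * Qv + (c0 a γ₀ d * (3 : ℝ) ^ d) * Rv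
        + (c0 a γ₀ d * (3 : ℝ) ^ d) * Ps + (c0 a γ₀ d * (3 : ℝ) ^ d) * Qs + (c0 a γ₀ d * (3 : ℝ) ^ d) * Rs := by
        ring
    _ ≤ a / 8 * Pv + γ₀ / 4 * Qv + γ₀ / 4 * Rv + a / 8 * Ps + γ₀ / 4 * Qs + 1 * Rs := by
        gcongr
    _ = a / 8 * Pv + γ₀ / 4 * Qv + γ₀ / 4 * Rv + a / 8 * Ps + γ₀ / 4 * Qs + Rs := by ring

/-- The exchange of summations in the first inequality of (3.53):
`Σ_{k=0}^{K−1} α_k Σ_{j=0}^{k} c_j = Σ_{j=0}^{K−1} c_j Σ_{k=j}^{K−1} α_k`. [folklore: finite double sum, cite: Balaban1982Higgs2, (3.53) p.594] -/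
theorem sum353_exchange (K : ℕ) (α c : ℕ → ℝ) :
    ∑ k ∈ range K, α k * ∑ j ∈ range (k + 1), c j = ∑ j ∈ range K, c j * ∑ k ∈ Ico j K, α k := by
  simp_rw [mul_sum]
  rw [sum_comm' (t' := range K) (s' := fun j => Ico j K)]
  · refine sum_congr rfl fun j _ => sum_congr rfl fun k _ => by ring
  · intro k j
    simp only [mem_range, mem_Ico]
    omega

/-- The stopping rule puts every scale used in (3.47)–(3.54) below ε₀: for `k ≤ K − 1`, `Lᵏε ≤ L⁻¹ ε₀ ≤ ε₀`, hence
`1 + log(Lᵏε)⁻¹ ≥ 1 + log ε₀⁻¹` — the quantity that "ε₀ sufficiently small" (p. 594) makes large at EVERY scale of the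
run. [folklore: monotonicity of log, cite: Balaban1982Higgs2, p.582 + p.594] -/
theorem logScale_ge {L ε ε₀ : ℝ} {k K : ℕ} (hL : 1 ≤ L) (hε : 0 < ε) (hk : k < K) (hstop : L ^ K * ε ≤ ε₀) :
    1 + Real.log ε₀⁻¹ ≤ 1 + Real.log (L ^ k * ε)⁻¹ := by
  have hLk : 0 < L ^ k := by positivity
  have hx : 0 < L ^ k * ε := by positivity
  have hle : L ^ k * ε ≤ ε₀ := by
    have : L ^ k ≤ L ^ K := pow_le_pow_right₀ hL hk.le
    calc L ^ k * ε ≤ L ^ K * ε := mul_le_mul_of_nonneg_right this hε.le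
      _ ≤ ε₀ := hstop
  have hε₀ : 0 < ε₀ := lt_of_lt_of_le hx hle
  have : (ε₀)⁻¹ ≤ (L ^ k * ε)⁻¹ := by
    rw [inv_le_inv₀ hε₀ hx]; exact hle
  linarith [Real.log_le_log (inv_pos.mpr hε₀) this]

/-- The inner bound of (3.53), *"because K ≤ (log L)⁻¹ log ε⁻¹, K − k ≤ (log L)⁻¹ log(Lᵏε)⁻¹ and r ≥ 2"*: writing
`ℓ = log ε⁻¹` and `x_k = 1 + log(Lᵏε)⁻¹ = 1 + ℓ − k log L` (so that `r(Lᵏε) = R x_kʳ`), if `K log L ≤ ℓ` then for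
every j < K, `Σ_{k=j}^{K−1} Rᵈ x_k^{rd} · x_k ≤ (log L)⁻¹ Rᵈ x_j^{r(d+1)}`, i.e. `Σ_{k=j}^{K−1} r(Lᵏε)ᵈ (1 + log(Lᵏε)⁻¹)
≤ (R log L)⁻¹ r(Lʲε)^{d+1}`.  The kernel check uses `2 ≤ r` exactly at `x_j^{rd+2} ≤ x_j^{rd+r}`; with the printed
`r > 1` of (2.7) alone this step fails (cell GAPS.md G-pv04-2). [folklore: real arithmetic, cite: Balaban1982Higgs2, (3.53) p.594] -/
theorem inner353_bound {R r logL ℓ : ℝ} {d K j : ℕ} (hR : 0 ≤ R) (hr : 2 ≤ r) (hlogL : 0 < logL)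
    (hK : (K : ℝ) * logL ≤ ℓ) (hj : j < K) :
    ∑ k ∈ Ico j K, R ^ d * (1 + ℓ - k * logL) ^ (r * d) * (1 + ℓ - k * logL)
      ≤ R ^ d * (1 + ℓ - j * logL) ^ (r * ((d : ℝ) + 1)) / logL := by
  set x : ℕ → ℝ := fun k => 1 + ℓ - k * logL with hxdef
  have hxK : ∀ k, k < K → 1 ≤ x k := by
    intro k hk
    have hk' : (k : ℝ) + 1 ≤ K := by exact_mod_cast hk
    have : (k : ℝ) * logL + logL ≤ (K : ℝ) * logL := by nlinarith
    simp only [hxdef]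
    linarith
  have hxj : 1 ≤ x j := hxK j hj
  have hxj0 : 0 ≤ x j := le_trans zero_le_one hxj
  have hrd : 0 ≤ r * (d : ℝ) := by positivity
  -- each term is bounded by the j-th one
  have hterm : ∀ k ∈ Ico j K, R ^ d * (x k) ^ (r * d) * x k ≤ R ^ d * (x j) ^ (r * d) * x j := by
    intro k hk
    rw [mem_Ico] at hk
    have hk1 : 1 ≤ x k := hxK k hk.2
    have hkj : x k ≤ x j := by
      have : (j : ℝ) ≤ k := by exact_mod_cast hk.1
      simp only [hxdef]
      nlinarith
    have hRd : 0 ≤ R ^ d := by positivity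
    have h1 : (x k) ^ (r * d) ≤ (x j) ^ (r * d) :=
      Real.rpow_le_rpow (le_trans zero_le_one hk1) hkj hrd
    have h2 : 0 ≤ (x j) ^ (r * (d : ℝ)) := Real.rpow_nonneg hxj0 _
    calc R ^ d * (x k) ^ (r * d) * x k ≤ R ^ d * (x j) ^ (r * d) * x k := by
          gcongr
      _ ≤ R ^ d * (x j) ^ (r * d) * x j := by
          have : 0 ≤ R ^ d * (x j) ^ (r * (d : ℝ)) := mul_nonneg hRd h2
          exact mul_le_mul_of_nonneg_left hkj this
  have hcard : ((Ico j K).card : ℝ) = (K : ℝ) - j := by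
    rw [Nat.card_Ico]; push_cast [Nat.cast_sub hj.le]; ring
  have hcount : ((K : ℝ) - j) * logL ≤ x j := by
    simp only [hxdef]; nlinarith
  have hsum : ∑ k ∈ Ico j K, R ^ d * (x k) ^ (r * d) * x k ≤ ((K : ℝ) - j) * (R ^ d * (x j) ^ (r * d) * x j) := by
    calc ∑ k ∈ Ico j K, R ^ d * (x k) ^ (r * d) * x k ≤ ∑ k ∈ Ico j K, R ^ d * (x j) ^ (r * d) * x j :=
          sum_le_sum hterm
      _ = ((Ico j K).card : ℝ) * (R ^ d * (x j) ^ (r * d) * x j) := by rw [sum_const, nsmul_eq_mul]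
      _ = ((K : ℝ) - j) * (R ^ d * (x j) ^ (r * d) * x j) := by rw [hcard]
  -- x_j^{rd} · x_j · x_j = x_j^{rd+2} ≤ x_j^{rd+r} = x_j^{r(d+1)}
  have hpow : (x j) ^ (r * d) * x j * x j ≤ (x j) ^ (r * ((d : ℝ) + 1)) := by
    have hxj' : 0 < x j := lt_of_lt_of_le zero_lt_one hxj
    have e1 : (x j) ^ (r * d) * x j * x j = (x j) ^ (r * (d : ℝ) + 2) := by
      rw [Real.rpow_add hxj', Real.rpow_two]; ring
    rw [e1]
    apply Real.rpow_le_rpow_of_exponent_le hxj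
    nlinarith
  have hRd : 0 ≤ R ^ d := by positivity
  have key : ((K : ℝ) - j) * (R ^ d * (x j) ^ (r * d) * x j) * logL ≤ R ^ d * (x j) ^ (r * ((d : ℝ) + 1)) := by
    have h2 : 0 ≤ R ^ d * (x j) ^ (r * (d : ℝ)) * x j :=
      mul_nonneg (mul_nonneg hRd (Real.rpow_nonneg hxj0 _)) hxj0
    calc ((K : ℝ) - j) * (R ^ d * (x j) ^ (r * d) * x j) * logL
          = (((K : ℝ) - j) * logL) * (R ^ d * (x j) ^ (r * d) * x j) := by ring
      _ ≤ x j * (R ^ d * (x j) ^ (r * d) * x j) := mul_le_mul_of_nonneg_right hcount h2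
      _ = R ^ d * ((x j) ^ (r * d) * x j * x j) := by ring
      _ ≤ R ^ d * (x j) ^ (r * ((d : ℝ) + 1)) := mul_le_mul_of_nonneg_left hpow hRd
  rw [le_div_iff₀ hlogL]
  exact le_trans (mul_le_mul_of_nonneg_right hsum hlogL.le) key

/-- The per-scale sign condition of (3.54).  With `x = 1 + log(Lᵏε)⁻¹ ≥ 1`, `p(Lᵏε) = b₀xᵖ`, `r(Lᵏε) = Rxʳ`: if
`2p ≥ (d+1)r` and the CONSTANT condition `O(1)·R^{d+1} ≤ c₀b₀² x^{2p−(d+1)r}` holds, then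
`O(1)·r(Lᵏε)^{d+1} ≤ c₀ p(Lᵏε)²`, i.e. the k-th coefficient of (3.54) is ≥ 0.  (When 2p = (d+1)r the constant condition
reads `O(1)R^{d+1} ≤ c₀b₀²`, independent of ε₀ — the printed "ε₀ sufficiently small" acts only through
`coeff354_threshold`, i.e. when the inequality is strict or the constants already comply; cell GAPS.md G-pv04-2.)
[folklore: real arithmetic, cite: Balaban1982Higgs2, (3.54) p.594] -/
theorem coeff354_nonneg {c₀ C b₀ R x p r : ℝ} {d : ℕ} (hx : 1 ≤ x)
    (hK : C * R ^ (d + 1) ≤ c₀ * b₀ ^ 2 * x ^ (2 * p - ((d : ℝ) + 1) * r)) :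
    C * (R * x ^ r) ^ (d + 1) ≤ c₀ * (b₀ * x ^ p) ^ 2 := by
  have hx0 : 0 < x := lt_of_lt_of_le zero_lt_one hx
  have e1 : (R * x ^ r) ^ (d + 1) = R ^ (d + 1) * x ^ (r * ((d : ℝ) + 1)) := by
    rw [mul_pow, ← Real.rpow_mul_natCast hx0.le]
    push_cast
    ring_nf
  have e2 : (b₀ * x ^ p) ^ 2 = b₀ ^ 2 * (x ^ (2 * p - ((d : ℝ) + 1) * r) * x ^ (r * ((d : ℝ) + 1))) := by
    rw [mul_pow, ← Real.rpow_mul_natCast hx0.le, ← Real.rpow_add hx0]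
    congr 2
    push_cast
    ring
  rw [e1, e2]
  have hxr : 0 ≤ x ^ (r * ((d : ℝ) + 1)) := Real.rpow_nonneg hx0.le _
  calc C * (R ^ (d + 1) * x ^ (r * ((d : ℝ) + 1))) = (C * R ^ (d + 1)) * x ^ (r * ((d : ℝ) + 1)) := by ring
    _ ≤ (c₀ * b₀ ^ 2 * x ^ (2 * p - ((d : ℝ) + 1) * r)) * x ^ (r * ((d : ℝ) + 1)) :=
        mul_le_mul_of_nonneg_right hK hxr
    _ = c₀ * (b₀ ^ 2 * (x ^ (2 * p - ((d : ℝ) + 1) * r) * x ^ (r * ((d : ℝ) + 1)))) := by ring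

/-- How "ε₀ sufficiently small" discharges the constant condition of `coeff354_nonneg` when the exponent inequality
is STRICT: if `2p > (d+1)r`, `c₀ > 0`, `b₀ > 0`, there is a threshold x₀ ≥ 1 with `O(1)R^{d+1} ≤ c₀b₀²x^{2p−(d+1)r}`
for all x ≥ x₀ (and every scale of a run has `x = 1 + log(Lᵏε)⁻¹ ≥ 1 + log ε₀⁻¹`, `logScale_ge`).
[folklore: real arithmetic, cite: Balaban1982Higgs2, (3.54) p.594] -/
theorem coeff354_threshold {c₀ b₀ C R p r : ℝ} {d : ℕ} (hc : 0 < c₀) (hb : 0 < b₀) (hC : 0 ≤ C) (hR : 0 ≤ R)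
    (hpr : ((d : ℝ) + 1) * r < 2 * p) :
    ∃ x₀ : ℝ, 1 ≤ x₀ ∧ ∀ x : ℝ, x₀ ≤ x → C * R ^ (d + 1) ≤ c₀ * b₀ ^ 2 * x ^ (2 * p - ((d : ℝ) + 1) * r) := by
  set δ : ℝ := 2 * p - ((d : ℝ) + 1) * r with hδ
  have hδ0 : 0 < δ := by rw [hδ]; linarith
  have hcb : 0 < c₀ * b₀ ^ 2 := by positivity
  set M : ℝ := C * R ^ (d + 1) / (c₀ * b₀ ^ 2) with hM
  have hM0 : 0 ≤ M := by rw [hM]; positivity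
  refine ⟨max 1 (M ^ (1 / δ)), le_max_left _ _, fun x hx => ?_⟩
  have hx1 : 1 ≤ x := le_trans (le_max_left _ _) hx
  have hx0 : 0 ≤ x := le_trans zero_le_one hx1
  have hMx : M ^ (1 / δ) ≤ x := le_trans (le_max_right _ _) hx
  have hMδ : M ≤ x ^ δ := by
    have h1 : (M ^ (1 / δ)) ^ δ ≤ x ^ δ :=
      Real.rpow_le_rpow (Real.rpow_nonneg hM0 _) hMx hδ0.le
    have h2 : (M ^ (1 / δ)) ^ δ = M := by
      rw [← Real.rpow_mul hM0, one_div_mul_cancel hδ0.ne', Real.rpow_one]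
    rw [h2] at h1
    exact h1
  have : C * R ^ (d + 1) = M * (c₀ * b₀ ^ 2) := by
    rw [hM, div_mul_cancel₀ _ hcb.ne']
  rw [this]
  calc M * (c₀ * b₀ ^ 2) ≤ x ^ δ * (c₀ * b₀ ^ 2) := mul_le_mul_of_nonneg_right hMδ hcb.le
    _ = c₀ * b₀ ^ 2 * x ^ δ := by ring

/-- (3.54) from the per-scale sign condition: if every coefficient `c₀p(Lᵏε)² − O(1)r(Lᵏε)^{d+1}` (k = 0 … K−1) is ≥ 0
then `−Σ_{k=0}^{K−1}(c₀p(Lᵏε)² − O(1)r(Lᵏε)^{d+1})|𝒞_k| ≤ 0`. [folklore: sum of nonnegative terms, cite: Balaban1982Higgs2, (3.54) p.594] -/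
theorem sum354_nonpos (K : ℕ) (coef vol : ℕ → ℝ) (hcoef : ∀ k, k < K → 0 ≤ coef k)
    (hvol : ∀ k, k < K → 0 ≤ vol k) :
    -(∑ k ∈ range K, coef k * vol k) ≤ 0 := by
  rw [neg_nonpos]
  exact sum_nonneg fun k hk => mul_nonneg (hcoef k (mem_range.mp hk)) (hvol k (mem_range.mp hk))

/-! ## ADDENDUM (unit `b2b-balaban-pv07`) — Proposition 3.1 (3.26) p. 589, its reduction (3.27)–(3.29) p. 589–590,
## and the conditional-integration formula (2.28) p. 563

These are the passages of this paper cited WITH A NUMBER elsewhere in the series (besides (3.42) above):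
B4 = [Balaban1983RegularityDecay] p. 574 *"The second theorem is connected with Proposition 3.1′ of [2] …"*, *"This
theorem implies (3.29) of [2]"* ([2] of B4 = this paper; typed there as `…B4.Prop31Printed`), and B13 =
[Balaban1988RG2Cluster] p. 12 *"The integrals above are represented in a similar way to (2.28) [6], namely as
conditioning on Z₀ᶜ"* ([6] via B12's reference list = this paper).

FINDING (cell DIVERGENCE.md D-pv07.4).  This paper contains NO statement numbered "Proposition 3.1′": Sect. 3.B prints
**Proposition 3.1** = inequality (3.26) (p. 589) and, inside its proof, the per-scale unit-lattice inequality **(3.29)**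
(p. 590), whose proof is DEFERRED — *"This inequality will be proved together with the properties of the covariances
(formulated in Propositions I.2.1 and I.2.3)."*  B4's "Proposition 3.1′ of [2]" ((1.21)–(1.22) p. 574) is B4's own
abstraction of (3.29) (generic unit-lattice region Ω, generic small parameter `e`, generic mass), and B4 supplies its
proof (§4 there).  What is typed below: (3.26) verbatim (`Prop31Printed`) and (3.29) verbatim (`Ineq329Printed`) over
abstract carriers naming the printed quantities; the printed reduction "(3.26) follows from (3.27), (3.28), the k = 0
term, and (3.29) for k = 1, …, K" kernel-checked as finite-sum arithmetic (`prop31_of_decoupling`), the rescaling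
identities behind *"Let us rescale the k-th term from the Lᵏε-lattice to the 1-lattice"* (`rescale_bond`,
`rescale_mass`), and B4's sentence *"This theorem implies (3.29) of [2]"* kernel-checked from `B4.Prop31Printed`
LITERALLY (`ineq329_of_prop31Printed`) under an explicit dictionary and with the two inputs the sentence leaves implicit
made HYPOTHESES: (a) what the *"suitable restrictions"* on φ′_k, Ã^η must deliver (B4's (1.21) for Ã^η; a bound
turning O(1)e^{2−α}Σ|φ′_k|² into O((Lᵏε)^{κ₀})|Λ_k|), (b) e := e(Lᵏε) below B4's smallness threshold — cell GAPS.md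
G-pv07-1 (located, not adjudicated: with e(Lᵏε) = e(Lᵏε)^{(4−d)/2} the B4 error carries (Lᵏε)^{(4−d)(2−α)/2}, i.e.
(Lᵏε)^{2−α} for d = 2 = the printed κ₀ of (2.11), and (Lᵏε)^{1−α/2} for d = 3 against the printed κ₀ = 1, α > 0
arbitrary; downstream ((2.118) p. 582, (3.31)) only κ₀ > 0 is used).  (2.28) is typed as a quoted display over
abstract integration functionals (`Display228`) — no Gaussian measure is constructed — together with the kernel-checked
completion of the square that produces the printed shift `−A_Λ⁻¹Aφ↾_{Λᶜ} + A_Λ⁻¹f` (`completeSquare228`).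

p. 589 [PDF 35], verbatim: *"**Proposition 3.1.** There exists a constant γ₀ > 0 dependent on the space dimension d
and the constant a only, and independent of ε and a choice of the sets Λ₅⁽⁰⁾, …, Λ₅⁽ᴷ⁻¹⁾, such that for arbitrary
configurations Ã^ε, Φ defined by the formulas (3.2), (3.3), (3.24), and satisfying the restrictions given by the
characteristic functions in (3.21), the following inequality holds
⟨Φ, Δ(Ã^ε)Φ⟩ ≥ γ₀ Σ_{k=0}^{K} Σ_{⟨x,x′⟩⊂Λ₅⁽ᵏ⁻¹⁾′∩Λ₅⁽ᵏ⁾ᶜ} (Lᵏε)^{d−2} |U(Ã^ε(⟨x,x′⟩))φ_k(x′) − φ_k(x)|²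
 + γ₀ Σ_{k=0}^{K} Σ_{x∈Λ₅⁽ᵏ⁻¹⁾′∩Λ₅⁽ᵏ⁾ᶜ} (Lᵏε)^d m² |φ_k(x)|² − Σ_{k=1}^{K} O((Lᵏε)^{κ₀}) |(Λ₅⁽ᵏ⁻¹⁾′∩Λ₅⁽ᵏ⁾ᶜ)₁|,  (3.26)
with κ₀ > 0. The last symbol in the above inequality denotes the measure of a set rescaled to the unit lattice, i.e.
the number of points in the set. We assume m² ≤ O(1) also. If Ã^ε = 0, then the inequality holds without the last sum
on the right side and without any restrictions on the configuration Φ."*  (Remark p. 589 on adding the cross terms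
(Lᵏε)^{d−2}|φ_k − Q(Ã^ε)φ_{k−1}|²: *"We will not use this generalization in the future."*  κ₀: p. 559, after (2.11):
*"κ₀ = 1 for d = 3 and κ₀ = 2 − α with arbitrary α > 0 for d = 2"*.)
Proof, p. 589–590, verbatim: *"… We estimate … using the Neumann boundary conditions … i.e. putting 0 instead of the
covariant derivatives in Δ(Ã^ε) for bonds joining the sets Bᵏ(Λ₅⁽ᵏ⁾ᶜ) and Bᵏ(Λ₅⁽ᵏ⁾) … ⟨Φ, Δ(Ã^ε)Φ⟩ ≥ ⟨Φ, Δ′(Ã^ε)Φ⟩,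
(3.27) … ⟨Φ, Δ′(Ã^ε)Φ⟩ = Σ_{k=0}^{K} ⟨φ_k, Δ^{(k),Lᵏε}(Bᵏ(Λ₅⁽ᵏ⁻¹⁾′∩Λ₅⁽ᵏ⁾ᶜ), Ã^ε)φ_k⟩. (3.28)  The term for k = 0
already has the form required by the right side of (3.26), so we need the inequalities for the remaining terms. Let
us rescale the kᵗʰ term from the Lᵏε-lattice to the 1-lattice, φ_k(x) = (Lᵏε)^{−(d−2)/2} φ′_k((Lᵏε)⁻¹x), and let
us denote for simplicity Λ_k = (Λ₅⁽ᵏ⁻¹⁾′∩Λ₅⁽ᵏ⁾ᶜ)₁. Now inequality (3.26) of the proposition follows from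
⟨φ′_k, Δ⁽ᵏ⁾(Bᵏ(Λ_k), Ã^η)φ′_k⟩ ≥ γ₀(Σ_{⟨x,x′⟩⊂Λ_k} |U(Ã^η(⟨x,x′⟩))φ′_k(x′) − φ′_k(x)|² + Σ_{x∈Λ_k} m²(Lᵏε)²|φ′_k(x)|²)
 − O((Lᵏε)^{κ₀})|Λ_k|,  (3.29)  with a constant γ₀ independent of k, Λ_k and for φ′_k, Ã^η satisfying suitable
restrictions. This inequality will be proved together with the properties of the covariances (formulated in
Propositions I.2.1 and I.2.3)."* -/

/-- Abstract carrier for ONE instance of Proposition 3.1 (3.26) p. 589: a lattice spacing `ε`, the number of steps `K`,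
a choice of the sets Λ₅⁽⁰⁾, …, Λ₅⁽ᴷ⁻¹⁾ and configurations Ã^ε, Φ = (φ₀, …, φ_K) as in (3.2), (3.3), (3.24), entering
only through: `restricted` — *"satisfying the restrictions given by the characteristic functions in (3.21)"*;
`zeroField` — *"Ã^ε = 0"*; `form` = ⟨Φ, Δ(Ã^ε)Φ⟩; `formN` = ⟨Φ, Δ′(Ã^ε)Φ⟩ (Neumann-decoupled, (3.27)); `term k` =
⟨φ_k, Δ^{(k),Lᵏε}(Bᵏ(Λ₅⁽ᵏ⁻¹⁾′∩Λ₅⁽ᵏ⁾ᶜ), Ã^ε)φ_k⟩ (the kᵗʰ term of (3.28)); `bond k` = Σ_{⟨x,x′⟩⊂Λ₅⁽ᵏ⁻¹⁾′∩Λ₅⁽ᵏ⁾ᶜ}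
(Lᵏε)^{d−2}|U(Ã^ε(⟨x,x′⟩))φ_k(x′) − φ_k(x)|²; `mass k` = Σ_{x∈Λ₅⁽ᵏ⁻¹⁾′∩Λ₅⁽ᵏ⁾ᶜ}(Lᵏε)^d m²|φ_k(x)|²; `vol k` =
|(Λ₅⁽ᵏ⁻¹⁾′∩Λ₅⁽ᵏ⁾ᶜ)₁| (number of points of the set rescaled to the unit lattice).  Nothing about these quantities is
assumed. [cite: Balaban1982Higgs2, Prop. 3.1 (3.26)–(3.28) p.589] -/
structure P31Setting where
  ε : ℝ
  K : ℕ
  restricted : Prop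
  zeroField : Prop
  form : ℝ
  formN : ℝ
  term : ℕ → ℝ
  bond : ℕ → ℝ
  mass : ℕ → ℝ
  vol : ℕ → ℕ

/-- **Proposition 3.1, inequality (3.26)** p. 589 (quoted in the section header), typed literally over a family of
instances sharing the constants of `P : Params` (d, L, a, κ₀): ∃ γ₀ > 0 (*"dependent on … d and the constant a only,
and independent of ε and a choice of the sets"*) and a constant C ≥ 0 for the printed O(·) such that every `restricted`
instance satisfies (3.26) with error Σ_{k=1}^{K} C(Lᵏε)^{κ₀}·vol k, and every instance with Ã^ε = 0 satisfies it
*"without the last sum on the right side and without any restrictions on the configuration Φ"*.  (The printed "We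
assume m² ≤ O(1) also" is a standing hypothesis on the model constants, not a field of the instance; the field `P.γ₀`
of `Params` above is the NAME under which Sect. 3.C — (3.31), the constant c₀ of (3.46) — uses the γ₀ produced here,
so a consumer instantiates the ∃ below with it.)  Quoted leaf:
its printed proof reduces it to (3.29), deferred to [B4] — see `prop31_of_decoupling`, `ineq329_of_prop31Printed`.
[cite: Balaban1982Higgs2, Prop. 3.1 (3.26) p.589] -/
def Prop31Printed (P : Params) {I : Type} (fam : I → P31Setting) : Prop :=
  ∃ γ₀ C : ℝ, 0 < γ₀ ∧ 0 ≤ C ∧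
    (∀ i, (fam i).restricted →
      γ₀ * (∑ k ∈ range ((fam i).K + 1), (fam i).bond k) + γ₀ * (∑ k ∈ range ((fam i).K + 1), (fam i).mass k)
        - (∑ k ∈ Icc 1 (fam i).K, C * ((P.L : ℝ) ^ k * (fam i).ε) ^ P.κ₀ * ((fam i).vol k : ℝ)) ≤ (fam i).form) ∧
    (∀ i, (fam i).zeroField →
      γ₀ * (∑ k ∈ range ((fam i).K + 1), (fam i).bond k) + γ₀ * (∑ k ∈ range ((fam i).K + 1), (fam i).mass k)
        ≤ (fam i).form)

/-- KERNEL-CHECKED bookkeeping of the printed reduction p. 589–590: from (3.27) `formN ≤ form`, (3.28) `formN =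
Σ_{k=0}^{K} term k`, the k = 0 term having *"already … the form required by the right side of (3.26)"* (`γ₀·bond 0 +
γ₀·mass 0 ≤ term 0`), and, for k = 1, …, K, the rescaled per-term inequality (3.29) `γ₀(bond k + mass k) − err k ≤
term k` (err k = O((Lᵏε)^{κ₀})|Λ_k|; the rescaling that identifies the kᵗʰ term of (3.26) with the right side of
(3.29) is `rescale_bond` / `rescale_mass`), inequality (3.26) follows with error Σ_{k=1}^{K} err k. [folklore] -/
theorem prop31_of_decoupling (K : ℕ) (γ₀ form formN : ℝ) (term bond mass err : ℕ → ℝ)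
    (h327 : formN ≤ form) (h328 : formN = ∑ k ∈ range (K + 1), term k)
    (h0 : γ₀ * bond 0 + γ₀ * mass 0 ≤ term 0)
    (h329 : ∀ k, 1 ≤ k → k ≤ K → γ₀ * (bond k + mass k) - err k ≤ term k) :
    γ₀ * (∑ k ∈ range (K + 1), bond k) + γ₀ * (∑ k ∈ range (K + 1), mass k) - ∑ k ∈ Icc 1 K, err k ≤ form := by
  have split : ∀ f : ℕ → ℝ, ∑ k ∈ range (K + 1), f k = f 0 + ∑ k ∈ Icc 1 K, f k := fun f => by
    rw [sum_range_eq_add_Ico f (by omega : 0 < K + 1), Finset.Ico_add_one_right_eq_Icc]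
  have hI : ∑ k ∈ Icc 1 K, (γ₀ * (bond k + mass k) - err k) ≤ ∑ k ∈ Icc 1 K, term k :=
    sum_le_sum fun k hk => h329 k (mem_Icc.mp hk).1 (mem_Icc.mp hk).2
  have hI' : ∑ k ∈ Icc 1 K, (γ₀ * (bond k + mass k) - err k)
      = γ₀ * (∑ k ∈ Icc 1 K, bond k) + γ₀ * (∑ k ∈ Icc 1 K, mass k) - ∑ k ∈ Icc 1 K, err k := by
    rw [sum_sub_distrib, ← mul_add, ← sum_add_distrib, mul_sum]
  rw [split bond, split mass]
  rw [split term] at h328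
  linarith

/-- KERNEL-CHECKED rescaling identity behind *"Let us rescale the kᵗʰ term from the Lᵏε-lattice to the 1-lattice,
φ_k(x) = (Lᵏε)^{−(d−2)/2}φ′_k((Lᵏε)⁻¹x)"* (p. 590), bond part: with s = Lᵏε > 0 and a value w of φ′_k (or of the
difference U(Ã(⟨x,x′⟩))φ′_k(x′) − φ′_k(x), the parallel transport being linear; one real component at a time),
(Lᵏε)^{d−2}·|(Lᵏε)^{−(d−2)/2}w|² = |w|² — the kᵗʰ bond term of (3.26) is the bond term of (3.29). [folklore] -/
theorem rescale_bond (s w : ℝ) (d : ℕ) (hs : 0 < s) :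
    s ^ ((d : ℝ) - 2) * (s ^ (-((d : ℝ) - 2) / 2) * w) ^ 2 = w ^ 2 := by
  have h : s ^ ((d : ℝ) - 2) * (s ^ (-((d : ℝ) - 2) / 2)) ^ 2 = 1 := by
    rw [← Real.rpow_natCast (s ^ (-((d : ℝ) - 2) / 2)) 2, ← Real.rpow_mul hs.le, ← Real.rpow_add hs]
    have he : (d : ℝ) - 2 + -((d : ℝ) - 2) / 2 * ((2 : ℕ) : ℝ) = 0 := by push_cast; ring
    rw [he, Real.rpow_zero]
  calc s ^ ((d : ℝ) - 2) * (s ^ (-((d : ℝ) - 2) / 2) * w) ^ 2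
      = (s ^ ((d : ℝ) - 2) * (s ^ (-((d : ℝ) - 2) / 2)) ^ 2) * w ^ 2 := by ring
    _ = w ^ 2 := by rw [h, one_mul]

/-- KERNEL-CHECKED rescaling identity, mass part: (Lᵏε)^d · m²|(Lᵏε)^{−(d−2)/2}w|² = m²(Lᵏε)²|w|² — the kᵗʰ mass term
of (3.26), Σ(Lᵏε)^d m²|φ_k(x)|², is the mass term Σ m²(Lᵏε)²|φ′_k(x)|² of (3.29) (so B4's generic mass `m²` in (1.22)
is instantiated as m²(Lᵏε)², cf. the setting dictionary of `…B1`, cell DIVERGENCE.md D-pv07.3). [folklore] -/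
theorem rescale_mass (s w m2 : ℝ) (d : ℕ) (hs : 0 < s) :
    s ^ (d : ℝ) * (m2 * (s ^ (-((d : ℝ) - 2) / 2) * w) ^ 2) = m2 * s ^ 2 * w ^ 2 := by
  have h : s ^ (d : ℝ) * (s ^ (-((d : ℝ) - 2) / 2)) ^ 2 = s ^ 2 := by
    rw [← Real.rpow_natCast (s ^ (-((d : ℝ) - 2) / 2)) 2, ← Real.rpow_mul hs.le, ← Real.rpow_add hs]
    have he : (d : ℝ) + -((d : ℝ) - 2) / 2 * ((2 : ℕ) : ℝ) = ((2 : ℕ) : ℝ) := by push_cast; ring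
    rw [he, Real.rpow_natCast]
  calc s ^ (d : ℝ) * (m2 * (s ^ (-((d : ℝ) - 2) / 2) * w) ^ 2)
      = m2 * (s ^ (d : ℝ) * (s ^ (-((d : ℝ) - 2) / 2)) ^ 2) * w ^ 2 := by ring
    _ = m2 * s ^ 2 * w ^ 2 := by rw [h]

/-- Abstract carrier for ONE instance of the deferred inequality (3.29) p. 590: a scale k with `s` = Lᵏε, the mass
`massSq` = m², a unit-lattice region Λ_k = (Λ₅⁽ᵏ⁻¹⁾′∩Λ₅⁽ᵏ⁾ᶜ)₁ with `vol` = |Λ_k| points, and configurations φ′_k, Ã^η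
entering through `restricted` — *"for φ′_k, Ã^η satisfying suitable restrictions"* (not specified on p. 590: the
restrictions carried by the characteristic functions of (3.21)) — and the three printed reals `form` = ⟨φ′_k,
Δ⁽ᵏ⁾(Bᵏ(Λ_k), Ã^η)φ′_k⟩, `covDiffSq` = Σ_{⟨x,x′⟩⊂Λ_k}|U(Ã^η(⟨x,x′⟩))φ′_k(x′) − φ′_k(x)|², `l2sq` = Σ_{x∈Λ_k}|φ′_k(x)|².
[cite: Balaban1982Higgs2, (3.29) p.590] -/
structure I329Setting where
  s : ℝ
  massSq : ℝ
  restricted : Prop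
  form : ℝ
  covDiffSq : ℝ
  l2sq : ℝ
  vol : ℕ

/-- **Inequality (3.29)** p. 590 (quoted in the section header), typed literally over a family of instances: *"with a
constant γ₀ independent of k, Λ_k"* (∃ γ₀ before the instance) and a uniform constant C ≥ 0 for the printed
O((Lᵏε)^{κ₀}): every `restricted` instance satisfies γ₀(covDiffSq + m²s²·l2sq) − C·s^{κ₀}·vol ≤ form.  DEFERRED in
print to [B4] ("Proposition 3.1′ of [2]" there); see `ineq329_of_prop31Printed` for what that implication needs.
[cite: Balaban1982Higgs2, (3.29) p.590] -/
def Ineq329Printed (κ₀ : ℝ) {I : Type} (fam : I → I329Setting) : Prop :=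
  ∃ γ₀ C : ℝ, 0 < γ₀ ∧ 0 ≤ C ∧ ∀ i, (fam i).restricted →
    γ₀ * ((fam i).covDiffSq + (fam i).massSq * (fam i).s ^ 2 * (fam i).l2sq)
      - C * (fam i).s ^ κ₀ * ((fam i).vol : ℝ) ≤ (fam i).form

/-- (3.29) for the sub-family of instances whose effective coupling `eEff i` (= e(Lᵏε) under the B4 dictionary) lies
below a threshold e₁ > 0 — the form in which B4's *"for e sufficiently small"* delivers it; in the paper every scale
has Lᵏε ≤ Lᴷε ≤ ε₀ (stopping rule p. 582), so e(Lᵏε) ≤ e·ε₀^{(4−d)/2} and the threshold is one more ε₀-smallness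
condition. [folklore] -/
def Ineq329Upto (κ₀ : ℝ) {I : Type} (fam : I → I329Setting) (eEff : I → ℝ) : Prop :=
  ∃ e₁ : ℝ, 0 < e₁ ∧ ∃ γ₀ C : ℝ, 0 < γ₀ ∧ 0 ≤ C ∧ ∀ i, (fam i).restricted → eEff i ≤ e₁ →
    γ₀ * ((fam i).covDiffSq + (fam i).massSq * (fam i).s ^ 2 * (fam i).l2sq)
      - C * (fam i).s ^ κ₀ * ((fam i).vol : ℝ) ≤ (fam i).form

/-- KERNEL-CHECKED reading of B4 p. 574 *"This theorem implies (3.29) of [2]"*, from `B4.Prop31Printed` LITERALLY.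
DICTIONARY (each (3.29)-instance i is sent to a B4 (1.22)-instance `toB4 i` and a configuration `cfg i` of it):
Ω⁽ᵏ⁾ := Λ_k (*"an arbitrary subset of Zᵈ"*), A := Ã^η, φ := φ′_k, so `form`, `covDiffSq`, `l2sq` agree; B4's mass
m² := m²(Lᵏε)² (`rescale_mass`); B4's small parameter e := `eEff i` (= e(Lᵏε) = e(Lᵏε)^{(4−d)/2}, as in (I.2.23)).
HYPOTHESES left implicit by the sentence and made explicit here (cell GAPS.md G-pv07-1): `hrestr` — the *"suitable
restrictions"* deliver B4's (1.21) |∂^ηÃ^η| ≤ O(1)p(e) (`reg121`), the unit-block hypothesis, and 0 < e; `hAbs` — for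
SOME α > 0 they also deliver a bound M with e^{2−α}Σ_{x∈Λ_k}|φ′_k(x)|² ≤ M(Lᵏε)^{κ₀}|Λ_k| (a sup-type restriction on
φ′_k combined with the exponent count (Lᵏε)^{(4−d)(2−α)/2} vs (Lᵏε)^{κ₀}).  CONCLUSION: (3.29) with γ₀ = B4's γ₀ and
C = C_{B4}(α)·M, on the instances below B4's threshold e₁ (`Ineq329Upto`). [folklore] -/
theorem ineq329_of_prop31Printed {I J : Type} (κ₀ : ℝ) (fam : I → I329Setting) (famB4 : J → B4.FormSetting)
    (toB4 : I → J) (cfg : ∀ i, (famB4 (toB4 i)).Cfg) (eEff : I → ℝ)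
    (hform : ∀ i, (famB4 (toB4 i)).form (cfg i) = (fam i).form)
    (hcov : ∀ i, (famB4 (toB4 i)).covDiffSq (cfg i) = (fam i).covDiffSq)
    (hl2 : ∀ i, (famB4 (toB4 i)).l2sq (cfg i) = (fam i).l2sq)
    (hmass : ∀ i, (famB4 (toB4 i)).massSq = (fam i).massSq * (fam i).s ^ 2)
    (he : ∀ i, (famB4 (toB4 i)).e = eEff i)
    (hrestr : ∀ i, (fam i).restricted →
      (famB4 (toB4 i)).unitBlocks ∧ (famB4 (toB4 i)).reg121 ∧ 0 < eEff i)
    (hAbs : ∃ α M : ℝ, 0 < α ∧ 0 ≤ M ∧ ∀ i, (fam i).restricted →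
      eEff i ^ ((2 : ℝ) - α) * (fam i).l2sq ≤ M * (fam i).s ^ κ₀ * ((fam i).vol : ℝ))
    (h : B4.Prop31Printed famB4) : Ineq329Upto κ₀ fam eEff := by
  obtain ⟨γ₀, e₁, hγ₀, he₁, hα⟩ := h
  obtain ⟨α, M, hαpos, hM, habs⟩ := hAbs
  obtain ⟨C, hC, hall⟩ := hα α hαpos
  refine ⟨e₁, he₁, γ₀, C * M, hγ₀, mul_nonneg hC hM, fun i hr hle => ?_⟩
  obtain ⟨hub, hreg, hpos⟩ := hrestr i hr
  have h122 := hall (toB4 i) hub hreg (by rw [he]; exact hpos) (by rw [he]; exact hle) (cfg i)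
  rw [hform, hcov, hl2, hmass, he] at h122
  have hb : C * (eEff i ^ ((2 : ℝ) - α) * (fam i).l2sq) ≤ C * (M * (fam i).s ^ κ₀ * ((fam i).vol : ℝ)) :=
    mul_le_mul_of_nonneg_left (habs i hr) hC
  have e1 : C * eEff i ^ ((2 : ℝ) - α) * (fam i).l2sq = C * (eEff i ^ ((2 : ℝ) - α) * (fam i).l2sq) := by ring
  have e2 : C * M * (fam i).s ^ κ₀ * ((fam i).vol : ℝ) = C * (M * (fam i).s ^ κ₀ * ((fam i).vol : ℝ)) := by ring
  rw [e2]
  rw [e1] at h122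
  linarith

/-! ### (2.28) p. 563 — conditional Gaussian integration (cited by B13 p. 12)

p. 563 [PDF 9], verbatim: *"Let us recall this operation in a general case. Let Ω be a finite set, Λ ⊂ Ω, and let A be
a positive operator on a space of field configurations on Ω, A_Λ its restriction on Λ. Then we have
∫Π_{x∈Ω}dφ(x) exp(−½⟨φ,Aφ⟩) exp(⟨f,φ⟩) F(φ↾_Λ) G(φ↾_{Λᶜ})
 = ∫Π_{x∈Ω}dφ(x) exp(−½⟨φ,Aφ⟩) exp(⟨f,φ⟩) G(φ↾_{Λᶜ}) · ∫dμ_{A_Λ⁻¹}(φ′) F(φ′ − A_Λ⁻¹Aφ↾_{Λᶜ} + A_Λ⁻¹f),  (2.28)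
where dμ_{A_Λ⁻¹} is a probabilistic Gaussian measure with the covariance A_Λ⁻¹."* -/

/-- Abstract carrier for ONE instance of (2.28) over the site type `S` of Ω (finite in `Display228`): the subset `Λ`, the positive operator `A`,
the source `f`, the functions `F` (of φ↾Λ; fed full configurations, its dependence on Λ-components only being part of
the quotation) and `G` (of φ↾Λᶜ), and the two printed integration functionals, NOT constructed here: `gaussInt h` =
∫Π_{x∈Ω}dφ(x) exp(−½⟨φ,Aφ⟩) h(φ) and `condInt h` = ∫dμ_{A_Λ⁻¹}(φ′) h(φ′) (φ′ a configuration on Λ, extended by 0);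
`shift φ` = the configuration −A_Λ⁻¹(Aφ↾_{Λᶜ}) + A_Λ⁻¹f on Λ (extended by 0). [cite: Balaban1982Higgs2, (2.28) p.563] -/
structure CondSetting (S : Type) where
  Λ : Finset S
  A : Matrix S S ℝ
  f : S → ℝ
  F : (S → ℝ) → ℝ
  G : (S → ℝ) → ℝ
  gaussInt : ((S → ℝ) → ℝ) → ℝ
  condInt : ((S → ℝ) → ℝ) → ℝ
  shift : (S → ℝ) → (S → ℝ)

/-- **Formula (2.28)** p. 563 (quoted above), typed literally over the abstract carrier: the Gaussian integral of
exp⟨f,φ⟩·F(φ↾Λ)·G(φ↾Λᶜ) equals the Gaussian integral of exp⟨f,φ⟩·G(φ↾Λᶜ)·[∫dμ_{A_Λ⁻¹}(φ′)F(φ′ + shift φ)].  Quoted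
leaf (a standard Gaussian conditioning identity; the measures are not built here — the algebra fixing `shift` as the
conditional mean is `completeSquare228`).  Cited by B13 p. 12 only as the MODEL of a representation (*"in a similar way
to (2.28) [6], namely as conditioning on Z₀ᶜ"*). [cite: Balaban1982Higgs2, (2.28) p.563] -/
def Display228 {S : Type} [Fintype S] (X : CondSetting S) : Prop :=
  X.gaussInt (fun φ => Real.exp (∑ x, X.f x * φ x) * X.F φ * X.G φ)
    = X.gaussInt (fun φ => Real.exp (∑ x, X.f x * φ x) * X.G φ * X.condInt (fun φ' => X.F (φ' + X.shift φ)))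

open Matrix in
/-- KERNEL-CHECKED completion of the square behind (2.28): write φ = (x on Λ, y on Λᶜ), A in blocks (A_Λ = `A`
symmetric, A_{Λ,Λᶜ} = `B`, A_{Λᶜ,Λ} = Bᵀ, A_{Λᶜ,Λᶜ} = `D`), f = (fΛ, fC).  If μ solves A_Λ μ = fΛ − A_{Λ,Λᶜ}y — i.e.
μ = −A_Λ⁻¹(Aφ↾_{Λᶜ})↾_Λ + A_Λ⁻¹fΛ, the printed shift — then ½⟨φ,Aφ⟩ − ⟨f,φ⟩ = ½⟨x − μ, A_Λ(x − μ)⟩ + (a quantity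
independent of x); hence, at fixed φ↾Λᶜ, the x-integral is a Gaussian with covariance A_Λ⁻¹ centred at μ, which is
(2.28). [folklore] -/
theorem completeSquare228 {Λ C : Type} [Fintype Λ] [Fintype C]
    (A : Matrix Λ Λ ℝ) (B : Matrix Λ C ℝ) (D : Matrix C C ℝ) (hA : A.IsSymm)
    (fΛ x μ : Λ → ℝ) (fC y : C → ℝ) (hμ : A *ᵥ μ = fΛ - B *ᵥ y) :
    (1 / 2) * (x ⬝ᵥ (A *ᵥ x) + x ⬝ᵥ (B *ᵥ y) + y ⬝ᵥ (Bᵀ *ᵥ x) + y ⬝ᵥ (D *ᵥ y)) - (fΛ ⬝ᵥ x + fC ⬝ᵥ y)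
      = (1 / 2) * ((x - μ) ⬝ᵥ (A *ᵥ (x - μ)))
        + ((1 / 2) * (y ⬝ᵥ (D *ᵥ y)) - fC ⬝ᵥ y - (1 / 2) * (μ ⬝ᵥ (A *ᵥ μ))) := by
  have h1 : y ⬝ᵥ (Bᵀ *ᵥ x) = x ⬝ᵥ (B *ᵥ y) := Matrix.dotProduct_transpose_mulVec B y x
  have h2 : μ ⬝ᵥ (A *ᵥ x) = x ⬝ᵥ (A *ᵥ μ) := by
    have := Matrix.dotProduct_transpose_mulVec A μ x
    rwa [hA.eq] at this
  have h3 : x ⬝ᵥ (A *ᵥ μ) = fΛ ⬝ᵥ x - x ⬝ᵥ (B *ᵥ y) := by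
    rw [hμ, dotProduct_sub, dotProduct_comm x fΛ]
  have h4 : (x - μ) ⬝ᵥ (A *ᵥ (x - μ))
      = x ⬝ᵥ (A *ᵥ x) - x ⬝ᵥ (A *ᵥ μ) - (μ ⬝ᵥ (A *ᵥ x) - μ ⬝ᵥ (A *ᵥ μ)) := by
    rw [Matrix.mulVec_sub, sub_dotProduct, dotProduct_sub, dotProduct_sub]
  rw [h4, h2, h3, h1]
  ring

/-! ## ADDENDUM 2 (unit `b2b-balaban-pv07`, gen 2; census G-B4-06 (c)) — Lemma 2.4 (2.65)–(2.66) p. 572, its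
## hypothesis (2.55) p. 570, and the gauge-away computation (2.68)–(2.75) pp. 572–573 of its proof

CONSUMER.  B4 = [Balaban1983RegularityDecay] §4, p. 591: *"inspect closely the proof of the Lemma II.2.4 … 'gauge
away' the configuration A₀ … Then using II.2.75 we have (4.9) φ^{(k)}(z) = (1/(1+m²))φ(x) + O(U(A₀(⟨x,x′⟩))φ(x′) −
φ(x)) …"* with φ^{(k)} = a_kG_k(Δ(x,x′),A₀)Q_k^*(A₀)φ there — i.e. B4 imports the PROOF MECHANISM (gauging away a
constant field, then (2.75)), not the statement (2.65)–(2.66).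
PRINTED (verbatim from the ×2 renders `…-p016 … p020-x2.png`).  p. 570: *"and the restrictions on the fields A, φ
given by the characteristic functions χ_k: |(∂A)(b)| ≤ c₁p(L^{k−1}ε), |A(x)| ≤ (c₁/(μ₀L^{k−1}ε)) p(L^{k−1}ε),
|(D_{Ā^{(k)}}φ)(b)| ≤ c₁p(L^{k−1}ε), |φ(x)| ≤ (c₁/λ(L^{k−1}ε)^{1/4}) p(L^{k−1}ε) for x ∈ Λ_{−1}^{(k−1)′}, (2.55)
b ⊂ Λ_{−1}^{(k−1)′}, Ā^{(k)}_b = L^{−k} Σ_{⟨x,x′⟩⊂b} A^{(k)}_{⟨x,x′⟩}."*; *"only, η = L^{−k}, where of course φ^{(k)} =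
a_kG_k(B^k(Λ₂^{(k−1)′}),A^{(k)})Q_k^*(A^{(k)})Λ₆^{(k−1)′}φ. (2.56)"*.  p. 571: *"G_kQ_k^*1 = a_k^{−1}G_ka_kP_kQ_k^*1 =
a_k^{−1}G_k(−Δ^η + μ₀²(L^kε)² + a_kP_k)1 − (μ₀²(L^kε)²/a_k) G_kQ_k^*1. (2.62) Hence (a_kG_kQ_k^*1)(x) = 1 −
μ₀²(L^kε)²/(a_k + μ₀²(L^kε)²), (2.63)"*.  p. 572: *"**Lemma 2.4.** Under the restrictions (2.55) we have
φ^{(k)}(x) = U(A^{(k)}(Γ^{(k)}_{x,y}))φ(y) + O(p(L^kε)) = (Q_k^*(A^{(k)})φ)(x) + O(p(L^kε)), for x ∈ B^k(y),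
y ∈ Λ₇^{(k−1)′}, (2.65)   (D^η_{A^{(k)}}φ^{(k)})(b) = O(p(L^kε)) for b ⊂ B^k(Λ₇^{(k−1)′}). (2.66)"*  Proof, p. 572:
*"Let us define □₁, □₂ as the sums of large blocks contained in Λ₇^{(k−1)′} and distant from the point y less than
2r(L^kε), 4r(L^kε) respectively, and let us denote □ = B^k(□₂). … Using Proposition 2.2 and the restrictions (2.55) we
get φ^{(k)}(x) = (a_kG_k(□,A^{(k)})Q_k^*(A^{(k)})□₁φ)(x) + O((L^kε)^κ), x ∈ B^k(y), (2.67) … Let us denote by A₀ a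
constant configuration equal to A^{(k)}(y) at each point, thus A^{(k)} − A₀ = O(p(L^kε)r(L^kε)). Using the expansion
formula (I.3.44) and Proposition I.2.2. we have (a_kG_k(□,A^{(k)})Q_k^*(A^{(k)})□₁φ)(x) = (a_kG_k(□,A₀)Q_k^*(A₀)□₁φ)(x)
+ (a_kG_k(□,A₀)F_{2,k}(A^{(k)} − A₀,A₀)□₁φ)(x) + (a_kG_k(□,A₀)V_k(A^{(k)} − A₀,A₀)G_k(□,A^{(k)})Q_k^*(A^{(k)})□₁φ)(x) =
(a_kG_k(□,A₀)Q_k^*(A₀)□₁φ)(x) + O((L^kε)^{κ₀}), κ₀ > 0, (2.68)"* [the middle term is F_{2,k}^*: Q_k^*(A^{(k)}) =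
Q_k^*(A₀) + F_{2,k}(A^{(k)} − A₀,A₀)^* by (I.3.15)] *"… Now the constant field A₀ can be "gauged out" from the last
expression above. We use a gauge transformation defined on □ by the formula φ₀(x) = U(A₀(Γ_{x,y}))φ₀′(x), x ∈ □, where
the contour Γ_{x,y} = −Γ_{y,x} is defined as in (I.2.1.), but now for the points x from □ instead of the block B(y).
… (D^η_{A₀}φ₀)(b) = η^{−1}(U(A_{0,b})U(A₀(Γ_{b₊,y}))φ₀′(b₊) − U(A₀(Γ_{b₋,y}))φ₀′(b₋)) =
U(A₀(Γ_{b₋,y}))η^{−1}(U(A₀(Γ_{y,b₋} ∪ b ∪ Γ_{b₊,y}))φ₀′(b₊) − φ₀′(b₋)), (2.69) but the contour Γ_{y,b₋} ∪ b ∪ Γ_{b₊,y}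
is closed and bounds some surface Σ ⊂ □, so using Stokes' theorem we have A₀(Γ_{y,b₋} ∪ b ∪ Γ_{b₊,y}) = A₀(∂Σ) =
∂^ηA₀(Σ) = 0, hence (D^η_{A₀}φ₀)(b) = U(A₀(Γ_{b₋,y}))(∂^ηφ₀′)(b), and |(D^η_{A₀}φ₀)(b)|² = |(∂^ηφ₀′)(b)|² for b ⊂ □.
(2.70)"*  p. 573: *"(Q_k(A₀)φ₀)(y′) = U(A₀(Γ_{y′,y}))(Q_kφ₀′)(y′) and |(Q_k(A₀)φ₀)(y′)|² = |(Q_kφ₀′)(y′)|². (2.72) Hence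
the operator +Δ^{η,N}_{A₀,□} + m²(L^kε)² + a_kP_k(A₀)□"* [so printed: −Δ is meant] *"is transformed into the operator
−Δ^{η,N}_{0,□} + m²(L^kε)² + a_kP_k□, and we have G_k(□,A₀;x,x′) = U(A₀(Γ_{x,y}))G_k(□,0;x,x′)U(A₀(Γ_{y,x′})). (2.73)
… (a_kG_k(□,A₀)Q_k^*(A₀)□₁φ)(x) = U(A₀(Γ_{x,y}))(a_kG_k(□,0)Q_k^*□₁φ′)(x). (2.74) … Now we can apply the same
reasoning to the configuration a_kG_k(□,0)Q_k^*□₁φ′ as to A^{(k)} in the proof of Lemma 2.3, especially we have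
a_kG_k(□,0)Q_k^*1 = G_k(□,0)(−Δ^{η,N}_{0,□} + m²(L^kε) + a_kP_k□)1 − m²(L^kε)²G_k(□,0)Q_k^*1 = 1 −
m²(L^kε)²G_k(□,0)Q_k^*1, (2.75)"* [so printed: the first mass term without its square] *"so the same conclusion
holds and we get (a_kG_k(□,0)Q_k^*□₁φ′)(x) = φ′(y) + O(p(L^kε)), x ∈ B^k(y). (2.76)"*  p. 574: *"Using again the
similar considerations as in the proof of Lemma 2.3 we get (2.66). This ends the proof of Lemma 2.4."*
WHAT IS KERNEL-CHECKED (elementary; nothing of the paper is asserted): (2.68)'s first equality from (I.3.44) and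
(I.3.15)^* as ring algebra (`display268_of_I344`); (2.69) from the group law of U (`display269`); the Stokes sentence
for a CONSTANT field — its holonomy along any closed lattice contour vanishes (`constHol_closed`, from
`constHol_eq_sum_netDisp`); (2.70) from (2.69) + that vanishing (`display270_of_269`); (2.73) as "the inverse of a
conjugate is the conjugate of the inverse" (`display273`); (2.75) — both printed equalities — from −Δ1 = 0, Q_k1 = 1,
Q_k^*1 = 1, P_k = Q_k^*Q_k and G_k = (−Δ + m²(L^kε)² + a_kP_k)^{−1} (`display275`), and its solved form
a_kG_kQ_k^*1 = (1 − μ/(a_k+μ))·1, μ = the mass term (`display263` = (2.63) with μ = μ₀²(L^kε)²).  Lemma 2.4 itself is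
the quoted leaf `Lemma24Printed`. -/

/-! ### Lemma 2.4 (2.65)–(2.66) p. 572 — quoted leaf -/

/-- Carrier for ONE instance of Lemma 2.4: a step k, fields A, φ on Λ₇^{(k−1)′} and the derived φ^{(k)} of (2.56),
recorded through the printed scalar quantities only.  `p` ↤ p(L^kε); `restr255` ↤ "the restrictions (2.55) hold" (for
the instance's A, φ, with the paper's c₁, μ₀, λ(·)); `dev265a` ↤ sup over y ∈ Λ₇^{(k−1)′}, x ∈ B^k(y) of
|φ^{(k)}(x) − U(A^{(k)}(Γ^{(k)}_{x,y}))φ(y)|; `dev265b` ↤ the same sup of |φ^{(k)}(x) − (Q_k^*(A^{(k)})φ)(x)|; `dev266` ↤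
sup over b ⊂ B^k(Λ₇^{(k−1)′}) of |(D^η_{A^{(k)}}φ^{(k)})(b)|. [cite: Balaban1982Higgs2, Lemma 2.4 p.572] -/
structure L24Setting where
  /-- p(L^kε). -/
  p : ℝ
  /-- The restrictions (2.55) p. 570 hold for this instance. -/
  restr255 : Prop
  /-- sup |φ^{(k)}(x) − U(A^{(k)}(Γ^{(k)}_{x,y}))φ(y)| over x ∈ B^k(y), y ∈ Λ₇^{(k−1)′}. -/
  dev265a : ℝ
  /-- sup |φ^{(k)}(x) − (Q_k^*(A^{(k)})φ)(x)| over the same range. -/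
  dev265b : ℝ
  /-- sup |(D^η_{A^{(k)}}φ^{(k)})(b)| over b ⊂ B^k(Λ₇^{(k−1)′}). -/
  dev266 : ℝ

/-- **Lemma 2.4** p. 572, PRINTED: *"Under the restrictions (2.55) we have φ^{(k)}(x) = U(A^{(k)}(Γ^{(k)}_{x,y}))φ(y) +
O(p(L^kε)) = (Q_k^*(A^{(k)})φ)(x) + O(p(L^kε)), for x ∈ B^k(y), y ∈ Λ₇^{(k−1)′}, (2.65)  (D^η_{A^{(k)}}φ^{(k)})(b) =
O(p(L^kε)) for b ⊂ B^k(Λ₇^{(k−1)′}). (2.66)"* — the O(·) read, as everywhere in the paper, with a constant uniform over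
the family of instances (all k, all fields obeying (2.55)).  A quoted leaf: consumed only as a hypothesis.
[cite: Balaban1982Higgs2, Lemma 2.4 (2.65)–(2.66) p.572] -/
def Lemma24Printed {I : Type} (fam : I → L24Setting) : Prop :=
  ∃ C : ℝ, ∀ i, (fam i).restr255 →
    (fam i).dev265a ≤ C * (fam i).p ∧ (fam i).dev265b ≤ C * (fam i).p ∧ (fam i).dev266 ≤ C * (fam i).p

/-! ### The proof's algebra, pp. 572–573, kernel-checked -/

/-- **(2.68), first equality**, KERNEL as ring algebra: with (I.3.44) G_{A} = G_{A₀} + G_{A₀}V_kG_{A} (`h344`; A =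
A^{(k)}, expanded around the constant A₀) and Q_k^*(A) = Q_k^*(A₀) + F_{2,k}(A − A₀,A₀)^* ((I.3.15) starred; `hQ`),
G_AQ_k^*(A) = G_{A₀}Q_k^*(A₀) + G_{A₀}F_{2,k}^* + G_{A₀}V_kG_AQ_k^*(A) — the three printed terms (the factor a_k and
the vector □₁φ ride along linearly).  DICTIONARY: `gA` ↤ G_k(□,A^{(k)}), `g0` ↤ G_k(□,A₀), `v` ↤ V_k(A^{(k)} − A₀,A₀),
`qsA` ↤ Q_k^*(A^{(k)}), `qs0` ↤ Q_k^*(A₀), `f2s` ↤ F_{2,k}(A^{(k)} − A₀,A₀)^*.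
[cite: Balaban1982Higgs2, (2.68) p.572] -/
theorem display268_of_I344 {𝔄 : Type} [Ring 𝔄] (gA g0 v qsA qs0 f2s : 𝔄) (h344 : gA = g0 + g0 * v * gA)
    (hQ : qsA = qs0 + f2s) : gA * qsA = g0 * qs0 + g0 * f2s + g0 * v * gA * qsA := by
  conv_lhs => rw [h344]
  rw [add_mul, hQ]
  noncomm_ring

/-- **(2.69)** p. 572, KERNEL from the group law: U is a representation of (R,+) (`hU`), the values of the constant
field's holonomies commute as real numbers.  DICTIONARY: `ab` ↤ A_{0,b}, `gp` ↤ A₀(Γ_{b₊,y}), `gm` ↤ A₀(Γ_{b₋,y})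
(so A₀(Γ_{y,b₋}) = −gm, Γ_{x,y} = −Γ_{y,x}), `φp`, `φm` ↤ φ₀′(b₊), φ₀′(b₋); the factor η^{−1} rides along linearly.
Conclusion ↤ U(A_{0,b})U(A₀(Γ_{b₊,y}))φ₀′(b₊) − U(A₀(Γ_{b₋,y}))φ₀′(b₋) = U(A₀(Γ_{b₋,y}))(U(A₀(Γ_{y,b₋} ∪ b ∪
Γ_{b₊,y}))φ₀′(b₊) − φ₀′(b₋)). [cite: Balaban1982Higgs2, (2.69) p.572] -/
theorem display269 {𝔄 V : Type} [Ring 𝔄] [AddCommGroup V] [Module 𝔄 V] (U : ℝ → 𝔄)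
    (hU : ∀ s t, U (s + t) = U s * U t) (ab gp gm : ℝ) (φp φm : V) :
    (U ab * U gp) • φp - U gm • φm = U gm • (U (-gm + ab + gp) • φp - φm) := by
  rw [smul_sub, ← mul_smul, ← hU, ← hU, show gm + (-gm + ab + gp) = ab + gp by ring]

/-- The holonomy A₀(Γ) = Σ_{b⊂Γ} A_{0,b} ((I.2.3), bonds with their orientation) of a CONSTANT field — value `c μ` on
every positively oriented bond of direction μ — along a lattice contour given as its list of steps (direction μ,
signed multiplicity). [cite: Balaban1982Higgs2, proof of Lemma 2.4 p.572] -/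
def constHol {d : ℕ} (c : Fin d → ℝ) (Γ : List (Fin d × ℤ)) : ℝ := (Γ.map fun s => (s.2 : ℝ) * c s.1).sum

/-- Net displacement of a lattice contour in direction μ. [folklore] -/
def netDisp {d : ℕ} (Γ : List (Fin d × ℤ)) (μ : Fin d) : ℤ := ((Γ.filter fun s => s.1 = μ).map fun s => s.2).sum

/-- A constant field's holonomy depends only on the net displacement: A₀(Γ) = Σ_μ (net μ-displacement of Γ)·c_μ.
KERNEL (induction on the contour). [folklore] -/
theorem constHol_eq_sum_netDisp {d : ℕ} (c : Fin d → ℝ) (Γ : List (Fin d × ℤ)) :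
    constHol c Γ = ∑ μ, (netDisp Γ μ : ℝ) * c μ := by
  induction Γ with
  | nil => simp [constHol, netDisp]
  | cons s Γ ih =>
    have hc : constHol c (s :: Γ) = (s.2 : ℝ) * c s.1 + constHol c Γ := by simp [constHol]
    have hn : ∀ μ, netDisp (s :: Γ) μ = (if s.1 = μ then s.2 else 0) + netDisp Γ μ := by
      intro μ
      by_cases h : s.1 = μ <;> simp [netDisp, h]
    rw [hc, ih]
    simp only [hn, Int.cast_add, add_mul, Finset.sum_add_distrib]
    congr 1
    rw [Finset.sum_eq_single s.1]
    · simp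
    · intro μ _ hμ; simp [Ne.symm hμ]
    · simp

/-- **The Stokes sentence** p. 572 (*"but the contour Γ_{y,b₋} ∪ b ∪ Γ_{b₊,y} is closed and bounds some surface Σ ⊂ □,
so using Stokes' theorem we have A₀(Γ_{y,b₋} ∪ b ∪ Γ_{b₊,y}) = A₀(∂Σ) = ∂^ηA₀(Σ) = 0"*), KERNEL in the form that
needs no surface: a CONSTANT field has zero holonomy along every closed lattice contour (zero net displacement in
every direction) — the exact algebra behind "gauging away" a constant abelian field (also the step B4 §4 p. 591 leans
on; census G-B4-07). [cite: Balaban1982Higgs2, proof of Lemma 2.4 p.572] -/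
theorem constHol_closed {d : ℕ} (c : Fin d → ℝ) (Γ : List (Fin d × ℤ)) (hclosed : ∀ μ, netDisp Γ μ = 0) :
    constHol c Γ = 0 := by
  simp [constHol_eq_sum_netDisp, hclosed]

/-- **(2.70)** ⇐ (2.69) + the Stokes sentence, KERNEL: if the closed contour's holonomy vanishes (`hstokes`) and
U(0) = 1, then U(A_{0,b})U(A₀(Γ_{b₊,y}))φ₀′(b₊) − U(A₀(Γ_{b₋,y}))φ₀′(b₋) = U(A₀(Γ_{b₋,y}))(φ₀′(b₊) − φ₀′(b₋)), i.e.
(D^η_{A₀}φ₀)(b) = U(A₀(Γ_{b₋,y}))(∂^ηφ₀′)(b) (the printed |·|² equality then is the unitarity of U, p. 605 of I).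
[cite: Balaban1982Higgs2, (2.70) p.572] -/
theorem display270_of_269 {𝔄 V : Type} [Ring 𝔄] [AddCommGroup V] [Module 𝔄 V] (U : ℝ → 𝔄)
    (hU : ∀ s t, U (s + t) = U s * U t) (hU0 : U 0 = 1) (ab gp gm : ℝ) (φp φm : V)
    (hstokes : -gm + ab + gp = 0) :
    (U ab * U gp) • φp - U gm • φm = U gm • (φp - φm) := by
  rw [display269 U hU, hstokes, hU0, one_smul]

/-- **(2.73)** p. 573, KERNEL as ring algebra: if the gauge transformation conjugates the operator, H_{A₀} = W H₀ W′
with W W′ = 1 = W′ W (`hu`, `hu'`; W ↤ multiplication by U(A₀(Γ_{x,y})), W′ ↤ by U(A₀(Γ_{y,x})) = its inverse), and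
G₀, G_{A₀} are the inverses of H₀, H_{A₀}, then G_{A₀} = W G₀ W′ — the printed G_k(□,A₀;x,x′) =
U(A₀(Γ_{x,y}))G_k(□,0;x,x′)U(A₀(Γ_{y,x′})). [cite: Balaban1982Higgs2, (2.73) p.573] -/
theorem display273 {𝔄 : Type} [Ring 𝔄] (u u' h0 hA g0 gA : 𝔄) (hu : u * u' = 1) (hu' : u' * u = 1)
    (hconj : hA = u * h0 * u') (hg0 : h0 * g0 = 1) (hgA : gA * hA = 1) : gA = u * g0 * u' := by
  have h1 : hA * (u * g0 * u') = 1 := by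
    rw [hconj]
    calc u * h0 * u' * (u * g0 * u') = u * h0 * (u' * u) * g0 * u' := by noncomm_ring
      _ = 1 := by rw [hu', mul_one, mul_assoc u h0 g0, hg0, mul_one, hu]
  calc gA = gA * (hA * (u * g0 * u')) := by rw [h1, mul_one]
    _ = u * g0 * u' := by rw [← mul_assoc, hgA, one_mul]

/-- **(2.75)** p. 573 (the computation (2.62) p. 571 repeated at A = 0), KERNEL over abstract linear data: `M` ↤
functions on □, `M'` ↤ functions on the block lattice, `Lap` ↤ −Δ^{η,N}_{0,□}, `Q` ↤ Q_k, `Qs` ↤ Q_k^*, `G` ↤ G_k(□,0),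
`one`, `one'` ↤ the constant functions 1, `μ` ↤ m²(L^kε)², `a` ↤ a_k.  Hypotheses = the paper's reasons: the Neumann
Laplacian kills constants (`hLap`), block averaging fixes constants (`hQ`) and so does its adjoint (`hQs`, used
silently in the middle member: a_kP_k1 = a_kQ_k^*1), G inverts −Δ + μ + a_kQ_k^*Q_k (`hG`).  Conclusions = the two
printed equalities of (2.75). [cite: Balaban1982Higgs2, (2.75) p.573; (2.62) p.571] -/
theorem display275 {M M' : Type} [AddCommGroup M] [Module ℝ M] [AddCommGroup M'] [Module ℝ M']
    (a μ : ℝ) (Lap G : M →ₗ[ℝ] M) (Q : M →ₗ[ℝ] M') (Qs : M' →ₗ[ℝ] M) (one : M) (one' : M')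
    (hLap : Lap one = 0) (hQ : Q one = one') (hQs : Qs one' = one)
    (hG : ∀ v, G (Lap v + μ • v + a • Qs (Q v)) = v) :
    a • G (Qs one') = G (Lap one + μ • one + a • Qs (Q one)) - μ • G (Qs one') ∧
      G (Lap one + μ • one + a • Qs (Q one)) - μ • G (Qs one') = one - μ • G (Qs one') := by
  constructor
  · simp only [hLap, hQ, hQs, zero_add, map_add, map_smul]
    abel
  · rw [hG]

/-- **(2.63)** p. 571 / the solved form of (2.75), KERNEL: from `display275`, (a + μ)·G Q^*1 = 1, hence
a·G Q^*1 = (1 − μ/(a + μ))·1 — printed as (a_kG_kQ_k^*1)(x) = 1 − μ₀²(L^kε)²/(a_k + μ₀²(L^kε)²) (2.63) (μ₀ = the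
vector-field mass there; m in (2.75)).  This is the exact constant behind (2.76) and B4 (4.9) (B4 prints 1/(1 + m²);
cell DIVERGENCE.md D-pv07.7 — immaterial there, the terms carrying it cancel by antisymmetry of q, B4 (4.10)).
[cite: Balaban1982Higgs2, (2.63) p.571; (2.75) p.573] -/
theorem display263 {M M' : Type} [AddCommGroup M] [Module ℝ M] [AddCommGroup M'] [Module ℝ M']
    (a μ : ℝ) (Lap G : M →ₗ[ℝ] M) (Q : M →ₗ[ℝ] M') (Qs : M' →ₗ[ℝ] M) (one : M) (one' : M')
    (hLap : Lap one = 0) (hQ : Q one = one') (hQs : Qs one' = one)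
    (hG : ∀ v, G (Lap v + μ • v + a • Qs (Q v)) = v) (haμ : a + μ ≠ 0) :
    a • G (Qs one') = (1 - μ / (a + μ)) • one := by
  obtain ⟨h1, h2⟩ := display275 a μ Lap G Q Qs one one' hLap hQ hQs hG
  have h : a • G (Qs one') = one - μ • G (Qs one') := h1.trans h2
  have h' : (a + μ) • G (Qs one') = one := by rw [add_smul, h]; abel
  have h'' : G (Qs one') = (a + μ)⁻¹ • one := by
    rw [← h', smul_smul, inv_mul_cancel₀ haμ, one_smul]
  rw [h'', smul_smul]
  congr 1
  field_simp
  ring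

end Literature.MathematicalPhysics.QuantumFieldTheory.Balaban1983to89.B2
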